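import Literature.NumberTheory.Sieve.MatomakiRadziwillProp1Inputs
import Literature.NumberTheory.LFunctions.DirichletPolynomialMeanValue
import HarnessLib

/-!
# Matomäki–Radziwiłł 2016, Lemma 12 (the Ramaré–Buchstab decomposition): proved

Topic `NumberTheory/Sieve`; a leaf of the decomposition of
`Literature.NumberTheory.Sieve.matomaki_radziwill` (Matomäki–Radziwiłł, Ann. of Math. 183 (2016),
Thm 1; see `MatomakiRadziwill.lean`, `MatomakiRadziwillProp1Inputs.lean`).  Lemma 12 of the paper
(§5, arXiv p. 13) is the identity-plus-mean-value-theorem step feeding Proposition 1 (§8).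

## Content

* `MatomakiRadziwill2016_lemma12_decomp` — NAMED FACT, Lemma 12 **as printed and correctly
  parenthesised**: `∫_𝒯 |∑_{X≤n≤2X} a_n n^{-1-it}|² dt ≤ C (H log(Q/P) · ∑_{j∈ℐ} ∫_𝒯 |Q_{j,H} R_{j,H}|² dt
  + (T+X)/X · (1/H + 1/P + ∑_{X≤n≤2X, (n,𝒫)=1} |a_n|²/n))`, with the hypotheses, block polynomials
  `blockPrimePoly`/`blockCofactorPoly` and conventions of `MatomakiRadziwill2016_lemma12`
  (`MatomakiRadziwillProp1Inputs.lean`).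
* `MatomakiRadziwill2016_lemma12_decomp_holds` — PROVED, with the absolute constant `C = 20000`
  (`MatomakiRadziwillLemma12.lemma12_bound`).
* `not_MatomakiRadziwill2016_lemma12` — PROVED: the earlier rendering `MatomakiRadziwill2016_lemma12`
  is **mis-parenthesised** — in `… * ∑ j ∈ ℐ, ∫ t in 𝒯, ‖Q_j R_j‖ ^ 2 + (T + X) / X * (…)` the body of
  `∫ t in 𝒯,` extends over `+ (T + X) / X * (…)`, so the whole right-hand side carries the factor
  `H log(Q/P)` and vanishes when `Q = P`; the statement is false (counterexample `X = T = H = 1`,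
  `P = Q = 2`, `a = b = c = 1`, `𝒯 = [-1, 1]`, where the left side is `≥ 1/2`).  That def is kept
  (append-only tree) but must not be used; `MatomakiRadziwill2016_lemma12_decomp` replaces it.

## Proof of Lemma 12 (paper §5, made quantitative)

With `𝒫` the primes of `[P, Q]`, `ω(n) = #{p ∈ 𝒫 : p ∣ n}` (`primeDivisorsIn`), `w = 1/(ω+1)`,
`A_p = {m : pm ∈ [X, 2X]}`, `M_j = [Xe^{-j/H}, 2Xe^{-j/H}]`, `j(p) = ⌊H log p⌋`:
`F(s) = ∑_{j∈ℐ} Q_{j,H} R_{j,H} + E3a - E3b - E2 + E1 + F_cop` (`decomposition`), where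
`E1 = ∑_p ∑_{m∈A_p, p∣m} a_{pm}(pm)^{-s}/ω(pm)`, `E2 = ∑_p ∑_{m∈A_p, p∣m} c_p b_m w_m (pm)^{-s}`,
`E3a = ∑_p c_p ∑_{m ∈ A_p ∖ M_{j(p)}} b_m w_m (pm)^{-s}` (supported on `pm ∈ [X, e^{1/H}X)`),
`E3b = ∑_p c_p ∑_{m ∈ M_{j(p)} ∖ A_p} b_m w_m (pm)^{-s}` (supported on `pm ∈ (2X, 2e^{1/H}X]`), and
`F_cop` is the part of `F` coprime to `𝒫` — this is the paper's identity (5) with the `p ∣ m` terms and the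
range replacement written out.  Then `|F|² ≤ 6(…)`, Cauchy–Schwarz over the `#ℐ ≤ H log(Q/P) + 2`
blocks, and the weak mean value theorem `∫_{-T}^{T} |∑_{n≤N} d_n n^{-it}|² ≤ (5T + 18N) ∑ |d_n|²`
(`LFunctions.dirichletPolynomial_meanSquare_le`, the paper's Lemma 6) for `E1, E2, E3a, E3b, F_cop`,
regrouped as Dirichlet polynomials in `n = pm` with coefficients `≤ 1`
(`sum_weights_le_one`: `∑_{p∣n} 1/(ω(n/p)+1) ≤ 1`) on supports of size `≤ 4X/P` (`p² ∣ n`),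
`≤ 2X/H + 1`, `≤ 4X/H + 1`.  The degenerate regimes `P > 2X` (no `n ≤ 2X` has a prime factor `≥ P`)
and `H log(Q/P) < 1` (then `#𝒫 ≤ 2P/H + 1`) are handled by bounding `F - F_cop` wholesale.
All constants are explicit; `C = 20000` is far from optimal.

## References

* K. Matomäki, M. Radziwiłł, *Multiplicative functions in short intervals*, Ann. of Math. (2) 183
  (2016), 1015–1056, doi:10.4007/annals.2016.183.3.6, arXiv:1501.04585, §5 Lemma 12 (arXiv p. 13),
  Lemma 6 (§4).
-/

noncomputable section

open Finset Complex MeasureTheory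

namespace Literature.NumberTheory.Sieve

namespace MatomakiRadziwillLemma12

/-! ### The weight `n^{-1-it}` -/

/-- `(pm)^{-s} = p^{-s} m^{-s}` for natural `p, m` (`s = 1 + it`). [folklore] -/
theorem cpw_mul (p m : ℕ) (t : ℝ) :
    ((p * m : ℕ) : ℂ) ^ (-(1 + (t : ℂ) * I)) =
      (p : ℂ) ^ (-(1 + (t : ℂ) * I)) * (m : ℂ) ^ (-(1 + (t : ℂ) * I)) := by
  rw [Nat.cast_mul, Complex.natCast_mul_natCast_cpow]

/-- `|n^{-1-it}| = 1/n` for `n ≥ 1`. [folklore] -/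
theorem norm_cpw {n : ℕ} (hn : 0 < n) (t : ℝ) :
    ‖(n : ℂ) ^ (-(1 + (t : ℂ) * I))‖ = (n : ℝ)⁻¹ := by
  rw [Complex.norm_natCast_cpow_of_pos hn]
  simp [Real.rpow_neg_one]

/-- `n^{-1-it} = n^{-1} · n^{-it}` for `n ≥ 1`. [folklore] -/
theorem cpw_eq_inv_mul {n : ℕ} (hn : 0 < n) (t : ℝ) :
    (n : ℂ) ^ (-(1 + (t : ℂ) * I)) = (n : ℂ)⁻¹ * (n : ℂ) ^ (-((t : ℂ) * I)) := by
  rw [neg_add, Complex.cpow_add _ _ (Nat.cast_ne_zero.2 hn.ne'), Complex.cpow_neg_one]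

/-- `t ↦ n^{-1-it}` is continuous. [folklore] -/
theorem continuous_cpw (n : ℕ) : Continuous fun t : ℝ => (n : ℂ) ^ (-(1 + (t : ℂ) * I)) := by
  refine Continuous.const_cpow (by fun_prop) (Or.inr fun t h0 => ?_)
  have := congrArg Complex.re h0
  simp at this

/-- A finite sum `∑_{n ∈ s} u_n n^{-1-it}` is continuous in `t`. [folklore] -/
theorem continuous_dsum (s : Finset ℕ) (u : ℕ → ℂ) :
    Continuous fun t : ℝ => ∑ n ∈ s, u n * (n : ℂ) ^ (-(1 + (t : ℂ) * I)) :=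
  continuous_finsetSum s fun n _ => continuous_const.mul (continuous_cpw n)

/-! ### Mean values -/

/-- `∫_𝒯 f ≤ ∫_{-T}^{T} f` for continuous `f ≥ 0` and `𝒯 ⊆ [-T, T]`. [folklore] -/
theorem setIntegral_le_intervalIntegral {f : ℝ → ℝ} (hf : Continuous f) (hf0 : ∀ t, 0 ≤ f t)
    {T : ℝ} (hT : 0 < T) {𝒯 : Set ℝ} (h𝒯 : 𝒯 ⊆ Set.Icc (-T) T) :
    ∫ t in 𝒯, f t ≤ ∫ t in -T..T, f t := by
  rw [intervalIntegral.integral_of_le (by linarith), ← integral_Icc_eq_integral_Ioc]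
  exact setIntegral_mono_set hf.integrableOn_Icc (Filter.Eventually.of_forall hf0) h𝒯.eventuallyLE

/-- The weak mean value theorem (`dirichletPolynomial_meanSquare_le`, Matomäki–Radziwiłł Lemma 6 in
the form `≪ (T + N) ∑ |a_n|²`) for the polynomial `∑_{n ≤ N'} d_n n^{-1-it}` on a subset
`𝒯 ⊆ [-T, T]`: `∫_𝒯 |∑ d_n n^{-1-it}|² dt ≤ (5T + 18N') ∑ |d_n|²/n²`. [folklore] -/
theorem meanvalue (d : ℕ → ℂ) (N' : ℕ) {T : ℝ} (hT : 0 < T) {𝒯 : Set ℝ}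
    (h𝒯 : 𝒯 ⊆ Set.Icc (-T) T) :
    ∫ t in 𝒯, ‖∑ n ∈ Icc 1 N', d n * (n : ℂ) ^ (-(1 + (t : ℂ) * I))‖ ^ 2 ≤
      (5 * T + 18 * N') * ∑ n ∈ Icc 1 N', ‖d n‖ ^ 2 / (n : ℝ) ^ 2 := by
  have key : ∀ t : ℝ, ∑ n ∈ Icc 1 N', d n * (n : ℂ) ^ (-(1 + (t : ℂ) * I)) =
      ∑ n ∈ Icc 1 N', d n / n * (n : ℂ) ^ (-((t : ℂ) * I)) := by
    intro t
    refine sum_congr rfl fun n hn => ?_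
    rw [cpw_eq_inv_mul (mem_Icc.1 hn).1 t]
    ring
  calc ∫ t in 𝒯, ‖∑ n ∈ Icc 1 N', d n * (n : ℂ) ^ (-(1 + (t : ℂ) * I))‖ ^ 2
      ≤ ∫ t in -T..T, ‖∑ n ∈ Icc 1 N', d n * (n : ℂ) ^ (-(1 + (t : ℂ) * I))‖ ^ 2 :=
        setIntegral_le_intervalIntegral ((continuous_dsum _ d).norm.pow 2) (fun t => sq_nonneg _)
          hT h𝒯
    _ = ∫ t in -T..T, ‖∑ n ∈ Icc 1 N', d n / n * (n : ℂ) ^ (-((t : ℂ) * I))‖ ^ 2 := by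
        simp_rw [key]
    _ ≤ (5 * T + 18 * N') * ∑ n ∈ Icc 1 N', ‖d n / n‖ ^ 2 :=
        LFunctions.dirichletPolynomial_meanSquare_le _ _ hT
    _ = (5 * T + 18 * N') * ∑ n ∈ Icc 1 N', ‖d n‖ ^ 2 / (n : ℝ) ^ 2 := by
        congr 1
        refine sum_congr rfl fun n _ => ?_
        rw [norm_div, div_pow]
        simp

/-! ### Regrouping a sum over pairs `(p, m)` as a Dirichlet polynomial in `n = pm` -/

/-- `∑_{p ∈ Ps} ∑_{m ∈ S_p} g(p, m) u(pm) = ∑_{n ≤ N'} (∑_{p ∈ Ps, p ∣ n, n/p ∈ S_p} g(p, n/p)) u(n)`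
when `p m ≤ N'` throughout. [folklore] -/
theorem sum_pairs_eq (Ps : Finset ℕ) (hPs : ∀ p ∈ Ps, 0 < p) (S : ℕ → Finset ℕ) (N' : ℕ)
    (hS : ∀ p ∈ Ps, ∀ m ∈ S p, 1 ≤ m ∧ p * m ≤ N') (g : ℕ → ℕ → ℂ) (u : ℕ → ℂ) :
    ∑ p ∈ Ps, ∑ m ∈ S p, g p m * u (p * m) =
      ∑ n ∈ Icc 1 N', (∑ p ∈ Ps with p ∣ n ∧ n / p ∈ S p, g p (n / p)) * u n := by
  have inner : ∀ p ∈ Ps, ∑ m ∈ S p, g p m * u (p * m) =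
      ∑ n ∈ Icc 1 N' with p ∣ n ∧ n / p ∈ S p, g p (n / p) * u n := by
    intro p hp
    have hp0 := hPs p hp
    refine Finset.sum_nbij' (fun m => p * m) (fun n => n / p) ?_ ?_ ?_ ?_ ?_
    · intro m hm
      obtain ⟨h1, h2⟩ := hS p hp m hm
      simp only [mem_filter, mem_Icc, Nat.mul_div_cancel_left m hp0]
      exact ⟨⟨le_trans h1 (Nat.le_mul_of_pos_left m hp0), h2⟩, dvd_mul_right p m, hm⟩
    · intro n hn
      rw [mem_filter] at hn
      exact hn.2.2
    · intro m _
      exact Nat.mul_div_cancel_left m hp0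
    · intro n hn
      rw [mem_filter] at hn
      exact Nat.mul_div_cancel' hn.2.1
    · intro m _
      simp [Nat.mul_div_cancel_left m hp0]
  have h : ∀ p n, p ∈ Ps ∧ n ∈ (Icc 1 N').filter (fun n => p ∣ n ∧ n / p ∈ S p) ↔
      p ∈ Ps.filter (fun p => p ∣ n ∧ n / p ∈ S p) ∧ n ∈ Icc 1 N' := by
    intro p n
    simp only [mem_filter]
    tauto
  rw [sum_congr rfl inner, Finset.sum_comm' h]
  simp_rw [sum_mul]

/-! ### The weights `1/(ω + 1)` -/

/-- For a finite set of primes `Ps` and `ω(k) = #{q ∈ Ps : q ∣ k}`: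
`∑_{p ∈ Ps, p ∣ n} 1/(ω(n/p) + 1) ≤ 1` (removing one prime factor lowers `ω` by at most one). [folklore] -/
theorem sum_weights_le_one (Ps : Finset ℕ) (hPs : ∀ p ∈ Ps, p.Prime) (n : ℕ) :
    ∑ p ∈ Ps with p ∣ n, (1 : ℝ) / (#(Ps.filter (· ∣ n / p)) + 1) ≤ 1 := by
  set k := #(Ps.filter (· ∣ n)) with hk
  have hle : ∀ p ∈ Ps.filter (· ∣ n), (1 : ℝ) / (#(Ps.filter (· ∣ n / p)) + 1) ≤ 1 / k := by
    intro p hp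
    have hpPs : p ∈ Ps := (mem_filter.1 hp).1
    have hpn : p ∣ n := (mem_filter.1 hp).2
    have hp' := hPs p hpPs
    have hsub : (Ps.filter (· ∣ n)).erase p ⊆ Ps.filter (· ∣ n / p) := by
      intro q hq
      rw [mem_erase, mem_filter] at hq
      rw [mem_filter]
      obtain ⟨hqp, hqPs, hqn⟩ := hq
      refine ⟨hqPs, ?_⟩
      have hq' := hPs q hqPs
      have : q ∣ n / p * p := by rwa [Nat.div_mul_cancel hpn]
      exact (hq'.dvd_mul.1 this).resolve_right
        fun h => hqp ((Nat.prime_dvd_prime_iff_eq hq' hp').1 h)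
    have hcard : k ≤ #(Ps.filter (· ∣ n / p)) + 1 := by
      have := card_le_card hsub
      rw [card_erase_of_mem hp] at this
      omega
    have hkpos : (0 : ℝ) < k := by exact_mod_cast card_pos.2 ⟨p, hp⟩
    exact one_div_le_one_div_of_le hkpos (by exact_mod_cast hcard)
  calc ∑ p ∈ Ps with p ∣ n, (1 : ℝ) / (#(Ps.filter (· ∣ n / p)) + 1)
      ≤ ∑ p ∈ Ps with p ∣ n, (1 : ℝ) / k := sum_le_sum hle
    _ = k * (1 / k) := by rw [sum_const, nsmul_eq_mul]
    _ ≤ 1 := by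
        rcases eq_or_ne (k : ℝ) 0 with h0 | h0
        · rw [h0]; norm_num
        · rw [mul_one_div_cancel h0]

/-- `ω(pm) = ω(m) + 1` for `p ∈ Ps`, `p ∤ m`. [folklore] -/
theorem card_filter_dvd_mul (Ps : Finset ℕ) (hPs : ∀ p ∈ Ps, p.Prime) {p m : ℕ} (hp : p ∈ Ps)
    (hpm : ¬ p ∣ m) : #(Ps.filter (· ∣ p * m)) = #(Ps.filter (· ∣ m)) + 1 := by
  have : Ps.filter (· ∣ p * m) = insert p (Ps.filter (· ∣ m)) := by
    ext q
    simp only [mem_filter, mem_insert]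
    constructor
    · rintro ⟨hq, hqd⟩
      rcases (hPs q hq).dvd_mul.1 hqd with h | h
      · exact Or.inl ((Nat.prime_dvd_prime_iff_eq (hPs q hq) (hPs p hp)).1 h)
      · exact Or.inr ⟨hq, h⟩
    · rintro (rfl | ⟨hq, h⟩)
      · exact ⟨hp, dvd_mul_right _ _⟩
      · exact ⟨hq, h.mul_left _⟩
  rw [this, card_insert_of_notMem]
  simp [mem_filter, hpm]

/-- `ω(n/p) + 1 ≥ ω(n)`-type bound in the form used for the error terms: for `p ∈ Ps`, `p ∣ n`,
`1/(ω(n/p) + 1) ≤ 1/ω(n)` is packaged in `sum_weights_le_one`; here the cruder `ω(pm) = ω(m)` when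
`p ∣ m`. [folklore] -/
theorem filter_dvd_mul_eq_of_dvd (Ps : Finset ℕ) (hPs : ∀ p ∈ Ps, p.Prime) {p m : ℕ} (hp : p ∈ Ps)
    (hpm : p ∣ m) : Ps.filter (· ∣ p * m) = Ps.filter (· ∣ m) := by
  ext q
  simp only [mem_filter, and_congr_right_iff]
  intro hq
  constructor
  · intro h
    rcases (hPs q hq).dvd_mul.1 h with h' | h'
    · rwa [(Nat.prime_dvd_prime_iff_eq (hPs q hq) (hPs p hp)).1 h']
    · exact h'
  · intro h
    exact h.mul_left _

/-! ### Blocks -/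

/-- The block condition `e^{v/H} ≤ p < e^{(v+1)/H}` says `v = ⌊H log p⌋`. [folklore] -/
theorem block_iff {H : ℝ} (hH : 0 < H) {p : ℕ} (hp : 1 ≤ p) (v : ℕ) :
    (Real.exp (v / H) ≤ p ∧ (p : ℝ) < Real.exp ((v + 1) / H)) ↔ ⌊H * Real.log p⌋₊ = v := by
  have hp0 : (0 : ℝ) < p := by exact_mod_cast hp
  have hlog : 0 ≤ H * Real.log p := mul_nonneg hH.le (Real.log_nonneg (by exact_mod_cast hp))
  rw [Nat.floor_eq_iff hlog, ← Real.le_log_iff_exp_le hp0, ← Real.log_lt_iff_lt_exp hp0,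
    div_le_iff₀ hH, lt_div_iff₀ hH, mul_comm (Real.log p) H]


/-! ### Counting lemmas -/

/-- `#{n ≤ M : d ∣ n} = ⌊M/d⌋ ≤ M/d`. [folklore] -/
theorem card_filter_dvd_le (M d : ℕ) : (#((Icc 1 M).filter (d ∣ ·)) : ℝ) ≤ (M : ℝ) / d := by
  have : #((Icc 1 M).filter (d ∣ ·)) = M / d := by
    rw [show (Icc 1 M) = Ioc 0 M from Finset.Icc_add_one_left_eq_Ioc 0 M]
    exact Nat.Ioc_filter_dvd_card_eq_div M d
  rw [this]
  exact Nat.cast_div_le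

/-- `#{n ≤ M : ∃ p ∈ 𝒫, p² ∣ n} ≤ ∑_{p ∈ 𝒫} M/p²`. [folklore] -/
theorem card_filter_exists_sq_dvd_le (Ps : Finset ℕ) (M : ℕ) :
    (#((Icc 1 M).filter (fun n => ∃ p ∈ Ps, p ^ 2 ∣ n)) : ℝ) ≤ ∑ p ∈ Ps, (M : ℝ) / (p : ℝ) ^ 2 := by
  have hsub : (Icc 1 M).filter (fun n => ∃ p ∈ Ps, p ^ 2 ∣ n) ⊆
      Ps.biUnion (fun p => (Icc 1 M).filter (p ^ 2 ∣ ·)) := by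
    intro n hn
    simp only [mem_filter, mem_biUnion] at hn ⊢
    obtain ⟨hn, p, hp, hpn⟩ := hn
    exact ⟨p, hp, hn, hpn⟩
  calc (#((Icc 1 M).filter (fun n => ∃ p ∈ Ps, p ^ 2 ∣ n)) : ℝ)
      ≤ #(Ps.biUnion (fun p => (Icc 1 M).filter (p ^ 2 ∣ ·))) := by exact_mod_cast card_le_card hsub
    _ ≤ ∑ p ∈ Ps, (#((Icc 1 M).filter (p ^ 2 ∣ ·)) : ℝ) := by exact_mod_cast card_biUnion_le
    _ ≤ ∑ p ∈ Ps, (M : ℝ) / (p : ℝ) ^ 2 := sum_le_sum fun p _ => by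
        have := card_filter_dvd_le M (p ^ 2)
        push_cast at this
        exact this

/-- `#{n ≤ M : ∃ p ∈ 𝒫, p ∣ n} ≤ ∑_{p ∈ 𝒫} M/p`. [folklore] -/
theorem card_filter_exists_dvd_le (Ps : Finset ℕ) (M : ℕ) :
    (#((Icc 1 M).filter (fun n => ∃ p ∈ Ps, p ∣ n)) : ℝ) ≤ ∑ p ∈ Ps, (M : ℝ) / (p : ℝ) := by
  have hsub : (Icc 1 M).filter (fun n => ∃ p ∈ Ps, p ∣ n) ⊆
      Ps.biUnion (fun p => (Icc 1 M).filter (p ∣ ·)) := by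
    intro n hn
    simp only [mem_filter, mem_biUnion] at hn ⊢
    obtain ⟨hn, p, hp, hpn⟩ := hn
    exact ⟨p, hp, hn, hpn⟩
  calc (#((Icc 1 M).filter (fun n => ∃ p ∈ Ps, p ∣ n)) : ℝ)
      ≤ #(Ps.biUnion (fun p => (Icc 1 M).filter (p ∣ ·))) := by exact_mod_cast card_le_card hsub
    _ ≤ ∑ p ∈ Ps, (#((Icc 1 M).filter (p ∣ ·)) : ℝ) := by exact_mod_cast card_biUnion_le
    _ ≤ ∑ p ∈ Ps, (M : ℝ) / (p : ℝ) := sum_le_sum fun p _ => card_filter_dvd_le M p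

/-- `∑_{P ≤ k ≤ Q} 1/k² ≤ 2/P` for `P ≥ 1`. [folklore] -/
theorem sum_Icc_inv_sq_le {P Q : ℝ} (hP : 1 ≤ P) :
    ∑ k ∈ Icc ⌈P⌉₊ ⌊Q⌋₊, ((k : ℝ) ^ 2)⁻¹ ≤ 2 / P := by
  have hK : 1 ≤ ⌈P⌉₊ := Nat.one_le_iff_ne_zero.2 (Nat.ceil_pos.2 (by linarith)).ne'
  have hsub : Icc ⌈P⌉₊ ⌊Q⌋₊ ⊆ Ioo (⌈P⌉₊ - 1) (⌊Q⌋₊ + 1) := by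
    intro k hk
    rw [mem_Icc] at hk
    rw [mem_Ioo]
    omega
  calc ∑ k ∈ Icc ⌈P⌉₊ ⌊Q⌋₊, ((k : ℝ) ^ 2)⁻¹
      ≤ ∑ k ∈ Ioo (⌈P⌉₊ - 1) (⌊Q⌋₊ + 1), ((k : ℝ) ^ 2)⁻¹ :=
        sum_le_sum_of_subset_of_nonneg hsub fun k _ _ => by positivity
    _ ≤ 2 / ((⌈P⌉₊ - 1 : ℕ) + 1) := sum_Ioo_inv_sq_le _ _
    _ = 2 / ⌈P⌉₊ := by
        congr 1
        have : ((⌈P⌉₊ - 1 : ℕ) : ℝ) = ⌈P⌉₊ - 1 := by rw [Nat.cast_sub hK, Nat.cast_one]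
        rw [this]
        ring
    _ ≤ 2 / P := div_le_div_of_nonneg_left (by norm_num) (by linarith) (Nat.le_ceil P)

/-- `#{⌊H log P⌋ ≤ j ≤ ⌊H log Q⌋} ≤ H log(Q/P) + 2` (`0 < P ≤ Q`, `H ≥ 0`). [folklore] -/
theorem card_blocks_le {H P Q : ℝ} (hH : 0 ≤ H) (hP : 1 ≤ P) (hPQ : P ≤ Q) :
    (#(Icc ⌊H * Real.log P⌋₊ ⌊H * Real.log Q⌋₊) : ℝ) ≤ H * Real.log (Q / P) + 2 := by
  have hlogP : 0 ≤ H * Real.log P := mul_nonneg hH (Real.log_nonneg hP)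
  have hlogQ : 0 ≤ H * Real.log Q := mul_nonneg hH (Real.log_nonneg (hP.trans hPQ))
  rw [Nat.card_Icc, Real.log_div (by linarith) (by linarith)]
  have h1 : ((⌊H * Real.log Q⌋₊ + 1 - ⌊H * Real.log P⌋₊ : ℕ) : ℝ) ≤
      (⌊H * Real.log Q⌋₊ : ℝ) + 1 - ⌊H * Real.log P⌋₊ := by
    have : ⌊H * Real.log P⌋₊ ≤ ⌊H * Real.log Q⌋₊ + 1 := Nat.le_succ_of_le
      (Nat.floor_le_floor (mul_le_mul_of_nonneg_left (Real.log_le_log (by linarith) hPQ) hH))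
    rw [Nat.cast_sub this]
    push_cast
    exact le_rfl
  have h2 : (⌊H * Real.log Q⌋₊ : ℝ) ≤ H * Real.log Q := Nat.floor_le hlogQ
  have h3 : H * Real.log P < ⌊H * Real.log P⌋₊ + 1 := Nat.lt_floor_add_one _
  linarith


/-! ### Notation for the concrete objects of Lemma 12 -/

/-- The primes of `[P, Q]`. -/
local notation "Pr[" P ", " Q "]" => Finset.filter Nat.Prime (Finset.Icc ⌈(P : ℝ)⌉₊ ⌊(Q : ℝ)⌋₊)
/-- The integers of `[X, 2X]`. -/
local notation "Nn[" X "]" => Finset.Icc ⌈(X : ℝ)⌉₊ ⌊2 * (X : ℝ)⌋₊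
/-- `n^{-1-it}`. -/
local notation "cw[" t ", " n "]" => (((n : ℕ) : ℂ) ^ (-(1 + ((t : ℝ) : ℂ) * Complex.I)))
/-- `A_p = {m : pm ∈ [X, 2X]}`. -/
local notation "Aa[" X ", " p "]" =>
  Finset.filter (fun m : ℕ => p * m ∈ Nn[X]) (Finset.Icc 1 ⌊2 * (X : ℝ)⌋₊)
/-- `M_v = [X e^{-v/H}, 2X e^{-v/H}] ∩ ℕ`. -/
local notation "Mm[" X ", " H ", " v "]" =>
  Finset.Icc ⌈(X : ℝ) * Real.exp (-(((v : ℕ) : ℝ) / (H : ℝ)))⌉₊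
    ⌊2 * (X : ℝ) * Real.exp (-(((v : ℕ) : ℝ) / (H : ℝ)))⌋₊
/-- The weight `1/(ω(m) + 1)`. -/
local notation "wt[" P ", " Q ", " m "]" => ((1 : ℂ) / ((primeDivisorsIn P Q m : ℂ) + 1))

/-- Membership in `Pr[P, Q]`: `p` prime with `P ≤ p ≤ Q` (`Q ≥ 0`). [folklore] -/
theorem mem_Pr {P Q : ℝ} (hQ : 0 ≤ Q) {p : ℕ} :
    p ∈ Pr[P, Q] ↔ p.Prime ∧ P ≤ p ∧ (p : ℝ) ≤ Q := by
  rw [mem_filter, mem_Icc, Nat.ceil_le, Nat.le_floor_iff hQ]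
  tauto

/-- `ω(k) = primeDivisorsIn P Q k = #{p ∈ Pr[P,Q] : p ∣ k}`. [folklore] -/
theorem primeDivisorsIn_eq (P Q : ℝ) (k : ℕ) :
    primeDivisorsIn P Q k = #((Pr[P, Q]).filter (· ∣ k)) := by
  rw [primeDivisorsIn, filter_filter]

/-- `‖wt‖ = 1/(ω + 1)`. [folklore] -/
theorem norm_wt (P Q : ℝ) (m : ℕ) :
    ‖wt[P, Q, m]‖ = 1 / ((primeDivisorsIn P Q m : ℝ) + 1) := by
  rw [norm_div, norm_one]
  congr 1
  have : ((primeDivisorsIn P Q m : ℂ) + 1) = ((primeDivisorsIn P Q m + 1 : ℕ) : ℂ) := by push_cast; ring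
  rw [this, Complex.norm_natCast]
  push_cast
  ring

/-- Members of `Nn[X]` are `≥ 1` when `X > 0`; and `Nn[X] ⊆ Icc 1 ⌊2X⌋`. [folklore] -/
theorem Nn_subset {X : ℝ} (hX : 0 < X) : Nn[X] ⊆ Icc 1 ⌊2 * X⌋₊ := by
  intro n hn
  rw [mem_Icc] at hn ⊢
  exact ⟨(Nat.one_le_iff_ne_zero.2 (Nat.ceil_pos.2 hX).ne').trans hn.1, hn.2⟩

/-- **Identity (5) of the paper, regrouped**: the part of `∑_{X ≤ n ≤ 2X} a_n n^{-s}` over the `n` with a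
prime factor in `[P, Q]` equals `∑_{p} ∑_{m ∈ A_p} a_{pm} (pm)^{-s} / ω(pm)`. [cite: MatomakiRadziwillAnnals2016, Lemma 12] -/
theorem sum_dvd_eq_sum_pairs {X : ℝ} (P Q : ℝ) (hX : 0 < X) (a : ℕ → ℂ) (t : ℝ) :
    ∑ n ∈ (Nn[X]).filter (fun n => ¬ ∀ p ∈ Pr[P, Q], ¬ p ∣ n), a n * cw[t, n] =
      ∑ p ∈ Pr[P, Q], ∑ m ∈ Aa[X, p],
        a (p * m) / (primeDivisorsIn P Q (p * m) : ℂ) * cw[t, p * m] := by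
  have hPs : ∀ p ∈ Pr[P, Q], 0 < p := fun p hp => (mem_filter.1 hp).2.pos
  have hS : ∀ p ∈ Pr[P, Q], ∀ m ∈ Aa[X, p], 1 ≤ m ∧ p * m ≤ ⌊2 * X⌋₊ := by
    intro p _ m hm
    rw [mem_filter, mem_Icc, mem_Icc] at hm
    exact ⟨hm.1.1, hm.2.2⟩
  rw [sum_pairs_eq (Pr[P, Q]) hPs (fun p => Aa[X, p]) ⌊2 * X⌋₊ hS
    (fun p m => a (p * m) / (primeDivisorsIn P Q (p * m) : ℂ)) (fun n => cw[t, n])]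
  symm
  have hsub : (Nn[X]).filter (fun n => ¬ ∀ p ∈ Pr[P, Q], ¬ p ∣ n) ⊆ Icc 1 ⌊2 * X⌋₊ :=
    (filter_subset _ _).trans (Nn_subset hX)
  rw [← sum_subset hsub ?zero]
  case zero =>
    intro n hn hnot
    -- `n ≤ 2X` but not (in `Nn` with a prime factor): the inner filter is empty or the sum vanishes
    have : (Pr[P, Q]).filter (fun p => p ∣ n ∧ n / p ∈ Aa[X, p]) = ∅ ∨
        n ∈ (Nn[X]).filter (fun n => ¬ ∀ p ∈ Pr[P, Q], ¬ p ∣ n) := by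
      by_cases h : (Pr[P, Q]).filter (fun p => p ∣ n ∧ n / p ∈ Aa[X, p]) = ∅
      · exact Or.inl h
      · right
        obtain ⟨p, hp⟩ := nonempty_iff_ne_empty.2 h
        rw [mem_filter] at hp
        obtain ⟨hp, hpn, hm⟩ := hp
        rw [mem_filter, Nat.mul_div_cancel' hpn] at hm
        rw [mem_filter]
        exact ⟨hm.2, fun hall => hall p hp hpn⟩
    rcases this with h | h
    · rw [h, sum_empty, zero_mul]
    · exact absurd h hnot
  refine sum_congr rfl fun n hn => ?_
  rw [mem_filter] at hn
  obtain ⟨hnN, hdiv⟩ := hn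
  have hn1 : 1 ≤ n := (mem_Icc.1 (Nn_subset hX hnN)).1
  have hfilt : (Pr[P, Q]).filter (fun p => p ∣ n ∧ n / p ∈ Aa[X, p]) = (Pr[P, Q]).filter (· ∣ n) := by
    ext p
    simp only [mem_filter, and_congr_right_iff]
    intro hp
    constructor
    · exact And.left
    · intro hd
      refine ⟨hd, ?_⟩
      rw [mem_Icc, Nat.mul_div_cancel' hd]
      refine ⟨⟨Nat.div_pos (Nat.le_of_dvd hn1 hd) hp.2.pos, (Nat.div_le_self _ _).trans ?_⟩, hnN⟩
      exact (mem_Icc.1 (Nn_subset hX hnN)).2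
  rw [hfilt]
  have hcongr : ∀ p ∈ (Pr[P, Q]).filter (· ∣ n),
      a (p * (n / p)) / (primeDivisorsIn P Q (p * (n / p)) : ℂ) = a n / (primeDivisorsIn P Q n : ℂ) := by
    intro p hp
    rw [Nat.mul_div_cancel' (mem_filter.1 hp).2]
  rw [sum_congr rfl hcongr, sum_const, nsmul_eq_mul, ← primeDivisorsIn_eq]
  have hω : (primeDivisorsIn P Q n : ℂ) ≠ 0 := by
    rw [primeDivisorsIn_eq, Nat.cast_ne_zero, ← pos_iff_ne_zero, card_pos]
    push Not at hdiv
    obtain ⟨p, hp, hpn⟩ := hdiv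
    exact ⟨p, mem_filter.2 ⟨hp, hpn⟩⟩
  rw [mul_div_cancel₀ _ hω]

/-- **The main term**: grouping the primes `p` by their block `⌊H log p⌋ = j` turns
`∑_p c_p p^{-s} ∑_{m ∈ M_{j(p)}} b_m w_m m^{-s}` into `∑_{j ∈ ℐ} Q_{j,H}(s) R_{j,H}(s)`.
[cite: MatomakiRadziwillAnnals2016, Lemma 12] -/
theorem main_eq (X : ℝ) {P Q H : ℝ} (hP : 1 ≤ P) (hPQ : P ≤ Q) (hH : 0 < H) (b c : ℕ → ℂ) (t : ℝ) :
    ∑ p ∈ Pr[P, Q], ∑ m ∈ Mm[X, H, ⌊H * Real.log p⌋₊],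
        c p * b m * wt[P, Q, m] * cw[t, p * m] =
      ∑ j ∈ Icc ⌊H * Real.log P⌋₊ ⌊H * Real.log Q⌋₊,
        blockPrimePoly c P Q H j t * blockCofactorPoly b X P Q H j t := by
  have hQ0 : 0 ≤ Q := by linarith
  have hmaps : ∀ p ∈ Pr[P, Q], ⌊H * Real.log p⌋₊ ∈ Icc ⌊H * Real.log P⌋₊ ⌊H * Real.log Q⌋₊ := by
    intro p hp
    rw [mem_Pr hQ0] at hp
    obtain ⟨hp, hPp, hpQ⟩ := hp
    have hp0 : (0 : ℝ) < p := by exact_mod_cast hp.pos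
    rw [mem_Icc]
    exact ⟨Nat.floor_le_floor (mul_le_mul_of_nonneg_left (Real.log_le_log (by linarith) hPp) hH.le),
      Nat.floor_le_floor (mul_le_mul_of_nonneg_left (Real.log_le_log hp0 hpQ) hH.le)⟩
  rw [← sum_fiberwise_of_maps_to hmaps]
  refine sum_congr rfl fun j _ => ?_
  have inner : ∀ p ∈ (Pr[P, Q]).filter (fun p : ℕ => ⌊H * Real.log (p : ℝ)⌋₊ = j),
      ∑ m ∈ Mm[X, H, ⌊H * Real.log p⌋₊], c p * b m * wt[P, Q, m] * cw[t, p * m] =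
        c p * cw[t, p] * ∑ m ∈ Mm[X, H, j], b m * wt[P, Q, m] * cw[t, m] := by
    intro p hp
    rw [(mem_filter.1 hp).2, mul_sum]
    refine sum_congr rfl fun m _ => ?_
    rw [cpw_mul]
    ring
  rw [sum_congr rfl inner, ← sum_mul]
  congr 1
  · rw [blockPrimePoly]
    refine sum_congr ?_ fun p _ => rfl
    ext p
    simp only [mem_filter, and_congr_right_iff]
    intro hp
    exact (block_iff hH hp.2.one_lt.le j).symm
  · rw [blockCofactorPoly]
    refine sum_congr rfl fun m _ => ?_
    ring


/-- **The decomposition of §5** (Ramaré–Buchstab type identity with explicit error terms):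
`F = Main + E3a - E3b - E2 + E1 + F_cop`, where `Main = ∑_{j ∈ ℐ} Q_{j,H} R_{j,H}`, `E1`, `E2` are
supported on the `n = pm` with `p ∣ m`, `E3a`, `E3b` come from replacing `{m : pm ∈ [X,2X]}` by the block
range `M_{j(p)}`, and `F_cop` is the part coprime to the primes of `[P, Q]`.
[cite: MatomakiRadziwillAnnals2016, Lemma 12] -/
theorem decomposition {X P Q H : ℝ} (hX : 0 < X) (hP : 1 ≤ P) (hPQ : P ≤ Q) (hH : 0 < H)
    (a b c : ℕ → ℂ)
    (hfac : ∀ m p : ℕ, p.Prime → P ≤ p → (p : ℝ) ≤ Q → ¬ p ∣ m → a (m * p) = b m * c p) (t : ℝ) :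
    ∑ n ∈ Nn[X], a n * cw[t, n] =
      (∑ j ∈ Icc ⌊H * Real.log P⌋₊ ⌊H * Real.log Q⌋₊,
          blockPrimePoly c P Q H j t * blockCofactorPoly b X P Q H j t)
      + (∑ p ∈ Pr[P, Q], ∑ m ∈ Aa[X, p] \ Mm[X, H, ⌊H * Real.log p⌋₊],
          c p * b m * wt[P, Q, m] * cw[t, p * m])
      - (∑ p ∈ Pr[P, Q], ∑ m ∈ Mm[X, H, ⌊H * Real.log p⌋₊] \ Aa[X, p],
          c p * b m * wt[P, Q, m] * cw[t, p * m])
      - (∑ p ∈ Pr[P, Q], ∑ m ∈ (Aa[X, p]).filter (fun m => p ∣ m),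
          c p * b m * wt[P, Q, m] * cw[t, p * m])
      + (∑ p ∈ Pr[P, Q], ∑ m ∈ (Aa[X, p]).filter (fun m => p ∣ m),
          a (p * m) / (primeDivisorsIn P Q (p * m) : ℂ) * cw[t, p * m])
      + ∑ n ∈ (Nn[X]).filter (fun n => ∀ p ∈ Pr[P, Q], ¬ p ∣ n), a n * cw[t, n] := by
  have hQ0 : 0 ≤ Q := by linarith
  have hPr : ∀ p ∈ Pr[P, Q], p.Prime := fun p hp => (mem_filter.1 hp).2
  have s1 := (sum_filter_add_sum_filter_not (Nn[X]) (fun n => ∀ p ∈ Pr[P, Q], ¬ p ∣ n)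
    (fun n => a n * cw[t, n])).symm
  have s2 := sum_dvd_eq_sum_pairs P Q hX a t
  have s3 : ∀ p ∈ Pr[P, Q],
      ∑ m ∈ Aa[X, p], a (p * m) / (primeDivisorsIn P Q (p * m) : ℂ) * cw[t, p * m] =
        (∑ m ∈ (Aa[X, p]).filter (fun m => p ∣ m),
            a (p * m) / (primeDivisorsIn P Q (p * m) : ℂ) * cw[t, p * m])
          + ((∑ m ∈ Aa[X, p], c p * b m * wt[P, Q, m] * cw[t, p * m])
            - ∑ m ∈ (Aa[X, p]).filter (fun m => p ∣ m),
                c p * b m * wt[P, Q, m] * cw[t, p * m]) := by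
    intro p hp'
    have hp := (mem_Pr hQ0).1 hp'
    obtain ⟨hpp, hPp, hpQ⟩ := hp
    have hfiltnot :
        ∑ m ∈ (Aa[X, p]).filter (fun m => ¬ p ∣ m),
            a (p * m) / (primeDivisorsIn P Q (p * m) : ℂ) * cw[t, p * m] =
          ∑ m ∈ (Aa[X, p]).filter (fun m => ¬ p ∣ m),
            c p * b m * wt[P, Q, m] * cw[t, p * m] := by
      refine sum_congr rfl fun m hm => ?_
      have hpm : ¬ p ∣ m := (mem_filter.1 hm).2
      have hω : primeDivisorsIn P Q (p * m) = primeDivisorsIn P Q m + 1 := by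
        rw [primeDivisorsIn_eq, primeDivisorsIn_eq, card_filter_dvd_mul _ hPr hp' hpm]
      rw [hω, show p * m = m * p from mul_comm p m, hfac m p hpp hPp hpQ hpm]
      push_cast
      ring
    rw [← sum_filter_add_sum_filter_not (Aa[X, p]) (fun m => p ∣ m), hfiltnot]
    congr 1
    rw [eq_sub_iff_add_eq, add_comm, sum_filter_add_sum_filter_not]
  have s5 : ∀ p ∈ Pr[P, Q], ∑ m ∈ Aa[X, p], c p * b m * wt[P, Q, m] * cw[t, p * m] =
      ∑ m ∈ Mm[X, H, ⌊H * Real.log p⌋₊], c p * b m * wt[P, Q, m] * cw[t, p * m]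
        + ∑ m ∈ Aa[X, p] \ Mm[X, H, ⌊H * Real.log p⌋₊], c p * b m * wt[P, Q, m] * cw[t, p * m]
        - ∑ m ∈ Mm[X, H, ⌊H * Real.log p⌋₊] \ Aa[X, p],
            c p * b m * wt[P, Q, m] * cw[t, p * m] := by
    intro p _
    have := Finset.sum_sdiff_sub_sum_sdiff (s₁ := Aa[X, p]) (s₂ := Mm[X, H, ⌊H * Real.log p⌋₊])
      (f := fun m => c p * b m * wt[P, Q, m] * cw[t, p * m])
    linear_combination this
  have s6 := main_eq X hP hPQ hH b c t
  rw [s1, s2, sum_congr rfl s3, sum_add_distrib, sum_sub_distrib, sum_congr rfl s5, sum_sub_distrib,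
    sum_add_distrib, s6]
  ring


/-! ### Squares of sums -/

/-- `|z₁ + z₂ - z₃ - z₄ + z₅ + z₆|² ≤ 6 (|z₁|² + ⋯ + |z₆|²)`. [folklore] -/
theorem norm_sq_six_le (z₁ z₂ z₃ z₄ z₅ z₆ : ℂ) :
    ‖z₁ + z₂ - z₃ - z₄ + z₅ + z₆‖ ^ 2 ≤
      6 * (‖z₁‖ ^ 2 + ‖z₂‖ ^ 2 + ‖z₃‖ ^ 2 + ‖z₄‖ ^ 2 + ‖z₅‖ ^ 2 + ‖z₆‖ ^ 2) := by
  have h : ‖z₁ + z₂ - z₃ - z₄ + z₅ + z₆‖ ≤ ‖z₁‖ + ‖z₂‖ + ‖z₃‖ + ‖z₄‖ + ‖z₅‖ + ‖z₆‖ := by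
    calc ‖z₁ + z₂ - z₃ - z₄ + z₅ + z₆‖
        ≤ ‖z₁ + z₂ - z₃ - z₄ + z₅‖ + ‖z₆‖ := norm_add_le _ _
      _ ≤ ‖z₁ + z₂ - z₃ - z₄‖ + ‖z₅‖ + ‖z₆‖ := by gcongr; exact norm_add_le _ _
      _ ≤ ‖z₁ + z₂ - z₃‖ + ‖z₄‖ + ‖z₅‖ + ‖z₆‖ := by gcongr; exact norm_sub_le _ _
      _ ≤ ‖z₁ + z₂‖ + ‖z₃‖ + ‖z₄‖ + ‖z₅‖ + ‖z₆‖ := by gcongr; exact norm_sub_le _ _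
      _ ≤ ‖z₁‖ + ‖z₂‖ + ‖z₃‖ + ‖z₄‖ + ‖z₅‖ + ‖z₆‖ := by gcongr; exact norm_add_le _ _
  have h0 : 0 ≤ ‖z₁ + z₂ - z₃ - z₄ + z₅ + z₆‖ := norm_nonneg _
  calc ‖z₁ + z₂ - z₃ - z₄ + z₅ + z₆‖ ^ 2 ≤ (‖z₁‖ + ‖z₂‖ + ‖z₃‖ + ‖z₄‖ + ‖z₅‖ + ‖z₆‖) ^ 2 :=
        pow_le_pow_left₀ h0 h 2
    _ ≤ 6 * (‖z₁‖ ^ 2 + ‖z₂‖ ^ 2 + ‖z₃‖ ^ 2 + ‖z₄‖ ^ 2 + ‖z₅‖ ^ 2 + ‖z₆‖ ^ 2) := by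
        nlinarith [sq_nonneg (‖z₁‖ - ‖z₂‖), sq_nonneg (‖z₁‖ - ‖z₃‖), sq_nonneg (‖z₁‖ - ‖z₄‖),
          sq_nonneg (‖z₁‖ - ‖z₅‖), sq_nonneg (‖z₁‖ - ‖z₆‖), sq_nonneg (‖z₂‖ - ‖z₃‖),
          sq_nonneg (‖z₂‖ - ‖z₄‖), sq_nonneg (‖z₂‖ - ‖z₅‖), sq_nonneg (‖z₂‖ - ‖z₆‖),
          sq_nonneg (‖z₃‖ - ‖z₄‖), sq_nonneg (‖z₃‖ - ‖z₅‖), sq_nonneg (‖z₃‖ - ‖z₆‖),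
          sq_nonneg (‖z₄‖ - ‖z₅‖), sq_nonneg (‖z₄‖ - ‖z₆‖), sq_nonneg (‖z₅‖ - ‖z₆‖)]

/-- `|z₁ + z₂|² ≤ 2 (|z₁|² + |z₂|²)`. [folklore] -/
theorem norm_sq_two_le (z₁ z₂ : ℂ) : ‖z₁ + z₂‖ ^ 2 ≤ 2 * (‖z₁‖ ^ 2 + ‖z₂‖ ^ 2) := by
  have h := norm_add_le z₁ z₂
  have h0 : 0 ≤ ‖z₁ + z₂‖ := norm_nonneg _
  calc ‖z₁ + z₂‖ ^ 2 ≤ (‖z₁‖ + ‖z₂‖) ^ 2 := pow_le_pow_left₀ h0 h 2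
    _ ≤ 2 * (‖z₁‖ ^ 2 + ‖z₂‖ ^ 2) := by nlinarith [sq_nonneg (‖z₁‖ - ‖z₂‖)]

/-- Cauchy–Schwarz: `|∑_{j ∈ s} z_j|² ≤ #s ∑ |z_j|²`. [folklore] -/
theorem norm_sq_sum_le (s : Finset ℕ) (z : ℕ → ℂ) :
    ‖∑ j ∈ s, z j‖ ^ 2 ≤ #s * ∑ j ∈ s, ‖z j‖ ^ 2 :=
  calc ‖∑ j ∈ s, z j‖ ^ 2 ≤ (∑ j ∈ s, ‖z j‖) ^ 2 :=
        pow_le_pow_left₀ (norm_nonneg _) (norm_sum_le _ _) 2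
    _ ≤ #s * ∑ j ∈ s, ‖z j‖ ^ 2 := sq_sum_le_card_mul_sum_sq

/-! ### Mean values of the error terms -/

/-- Mean value of a sum over pairs: if `p m ≤ N'` on the support and the regrouped coefficient at `n`
has `|·|² ≤ B n`, then `∫_𝒯 |∑_p ∑_{m ∈ S_p} g(p,m) (pm)^{-1-it}|² ≤ (5T + 18N') ∑_{n ≤ N'} B n / n²`.
[folklore] -/
theorem pairs_meanvalue (Ps : Finset ℕ) (hPs : ∀ p ∈ Ps, 0 < p) (S : ℕ → Finset ℕ) (N' : ℕ)
    (hS : ∀ p ∈ Ps, ∀ m ∈ S p, 1 ≤ m ∧ p * m ≤ N') (g : ℕ → ℕ → ℂ) {T : ℝ} (hT : 0 < T)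
    {𝒯 : Set ℝ} (h𝒯 : 𝒯 ⊆ Set.Icc (-T) T) (B : ℕ → ℝ)
    (hB : ∀ n ∈ Icc 1 N', ‖∑ p ∈ Ps with p ∣ n ∧ n / p ∈ S p, g p (n / p)‖ ^ 2 ≤ B n) :
    ∫ t in 𝒯, ‖∑ p ∈ Ps, ∑ m ∈ S p, g p m * cw[t, p * m]‖ ^ 2 ≤
      (5 * T + 18 * N') * ∑ n ∈ Icc 1 N', B n / (n : ℝ) ^ 2 := by
  have eq : ∀ t : ℝ, ∑ p ∈ Ps, ∑ m ∈ S p, g p m * cw[t, p * m] =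
      ∑ n ∈ Icc 1 N', (∑ p ∈ Ps with p ∣ n ∧ n / p ∈ S p, g p (n / p)) * cw[t, n] :=
    fun t => sum_pairs_eq Ps hPs S N' hS g (fun n => cw[t, n])
  simp_rw [eq]
  refine (meanvalue _ N' hT h𝒯).trans ?_
  have h0 : (0 : ℝ) ≤ 5 * T + 18 * N' := by positivity
  refine mul_le_mul_of_nonneg_left (sum_le_sum fun n hn => ?_) h0
  exact div_le_div_of_nonneg_right (hB n hn) (sq_nonneg _)

/-- Continuity of a sum over pairs in `t`. [folklore] -/
theorem continuous_pairs (Ps : Finset ℕ) (S : ℕ → Finset ℕ) (g : ℕ → ℕ → ℂ) :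
    Continuous fun t : ℝ => ∑ p ∈ Ps, ∑ m ∈ S p, g p m * cw[t, p * m] :=
  continuous_finsetSum Ps fun p _ => continuous_finsetSum (S p) fun m _ =>
    continuous_const.mul (continuous_cpw (p * m))

/-- Integrability on `𝒯 ⊆ [-T, T]` of a continuous function. [folklore] -/
theorem integrableOn_of_continuous {f : ℝ → ℝ} (hf : Continuous f) {T : ℝ} {𝒯 : Set ℝ}
    (h𝒯 : 𝒯 ⊆ Set.Icc (-T) T) : IntegrableOn f 𝒯 :=
  hf.integrableOn_Icc.mono_set h𝒯


/-- Indicator bound for the regrouped coefficients: if they are `≤ 1` in norm and supported where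
`cond` holds, then `|coeff n|² ≤ 1_{cond}(n)`. [folklore] -/
theorem coeff_sq_le_indicator (Ps : Finset ℕ) (S : ℕ → Finset ℕ) (g : ℕ → ℕ → ℂ) (N' : ℕ)
    (cond : ℕ → Prop) [DecidablePred cond]
    (hcoef : ∀ n ∈ Icc 1 N', ‖∑ p ∈ Ps with p ∣ n ∧ n / p ∈ S p, g p (n / p)‖ ≤ 1)
    (hsupp : ∀ n ∈ Icc 1 N', ∀ p ∈ Ps, p ∣ n → n / p ∈ S p → cond n) :
    ∀ n ∈ Icc 1 N', ‖∑ p ∈ Ps with p ∣ n ∧ n / p ∈ S p, g p (n / p)‖ ^ 2 ≤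
      if cond n then 1 else 0 := by
  intro n hn
  by_cases h : (Ps.filter (fun p => p ∣ n ∧ n / p ∈ S p)).Nonempty
  · obtain ⟨p, hp⟩ := h
    rw [mem_filter] at hp
    rw [if_pos (hsupp n hn p hp.1 hp.2.1 hp.2.2)]
    calc ‖∑ p ∈ Ps with p ∣ n ∧ n / p ∈ S p, g p (n / p)‖ ^ 2 ≤ 1 ^ 2 :=
          pow_le_pow_left₀ (norm_nonneg _) (hcoef n hn) 2
      _ = 1 := one_pow 2
  · rw [not_nonempty_iff_eq_empty.1 h, sum_empty, norm_zero]
    split_ifs <;> norm_num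

/-- `∑_{n ≤ N'} 1_{cond}(n)/n² ≤ #{n ≤ N' : cond n} / L²` when `cond n ⟹ n ≥ L > 0`. [folklore] -/
theorem sum_indicator_div_sq_le (N' : ℕ) (cond : ℕ → Prop) [DecidablePred cond] {L : ℝ}
    (hL : 0 < L) (hcond : ∀ n ∈ Icc 1 N', cond n → L ≤ n) :
    ∑ n ∈ Icc 1 N', (if cond n then (1 : ℝ) else 0) / (n : ℝ) ^ 2 ≤
      #((Icc 1 N').filter cond) / L ^ 2 := by
  have key : ∀ n ∈ Icc 1 N', (if cond n then (1 : ℝ) else 0) / (n : ℝ) ^ 2 ≤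
      if cond n then 1 / L ^ 2 else 0 := by
    intro n hn
    split_ifs with h
    · exact div_le_div_of_nonneg_left zero_le_one (by positivity)
        (pow_le_pow_left₀ hL.le (hcond n hn h) 2)
    · simp
  calc ∑ n ∈ Icc 1 N', (if cond n then (1 : ℝ) else 0) / (n : ℝ) ^ 2
      ≤ ∑ n ∈ Icc 1 N', if cond n then 1 / L ^ 2 else 0 := sum_le_sum key
    _ = ∑ n ∈ (Icc 1 N').filter cond, 1 / L ^ 2 := (sum_filter _ _).symm
    _ = #((Icc 1 N').filter cond) / L ^ 2 := by rw [sum_const, nsmul_eq_mul]; ring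

/-- The coefficients `∑_{p ∣ n, n/p ∈ S_p} c_p b_{n/p} w_{n/p}` are bounded by `1`
(`|b|, |c| ≤ 1` and `sum_weights_le_one`). [folklore] -/
theorem coeff_wt_le (P Q : ℝ) {b c : ℕ → ℂ} (hb : ∀ m, ‖b m‖ ≤ 1) (hc : ∀ p, ‖c p‖ ≤ 1)
    (S : ℕ → Finset ℕ) (n : ℕ) :
    ‖∑ p ∈ Pr[P, Q] with p ∣ n ∧ n / p ∈ S p, c p * b (n / p) * wt[P, Q, n / p]‖ ≤ 1 := by
  have hPr : ∀ p ∈ Pr[P, Q], p.Prime := fun p hp => (mem_filter.1 hp).2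
  calc ‖∑ p ∈ Pr[P, Q] with p ∣ n ∧ n / p ∈ S p, c p * b (n / p) * wt[P, Q, n / p]‖
      ≤ ∑ p ∈ Pr[P, Q] with p ∣ n ∧ n / p ∈ S p, ‖c p * b (n / p) * wt[P, Q, n / p]‖ :=
        norm_sum_le _ _
    _ ≤ ∑ p ∈ Pr[P, Q] with p ∣ n ∧ n / p ∈ S p, 1 / ((primeDivisorsIn P Q (n / p) : ℝ) + 1) :=
        sum_le_sum fun p _ => by
          rw [norm_mul, norm_mul, norm_wt]
          have h1 := hc p
          have h2 := hb (n / p)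
          have h3 : 0 ≤ 1 / ((primeDivisorsIn P Q (n / p) : ℝ) + 1) := by positivity
          calc ‖c p‖ * ‖b (n / p)‖ * (1 / ((primeDivisorsIn P Q (n / p) : ℝ) + 1))
              ≤ 1 * 1 * (1 / ((primeDivisorsIn P Q (n / p) : ℝ) + 1)) := by
                gcongr
            _ = _ := by ring
    _ ≤ ∑ p ∈ Pr[P, Q] with p ∣ n, 1 / ((primeDivisorsIn P Q (n / p) : ℝ) + 1) := by
        refine sum_le_sum_of_subset_of_nonneg (fun p hp => ?_) fun _ _ _ => by positivity
        rw [mem_filter] at hp ⊢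
        exact ⟨hp.1, hp.2.1⟩
    _ ≤ 1 := by
        simp_rw [primeDivisorsIn_eq]
        exact sum_weights_le_one _ hPr n

/-- The coefficients of `E1`, `∑_{p ∣ n, p ∣ n/p, …} a_n/ω(n)`, are bounded by `1`. [folklore] -/
theorem coeff_E1_le {X : ℝ} (P Q : ℝ) {a : ℕ → ℂ} (ha : ∀ n, ‖a n‖ ≤ 1) (n : ℕ) :
    ‖∑ p ∈ Pr[P, Q] with p ∣ n ∧ n / p ∈ (Aa[X, p]).filter (fun m => p ∣ m),
        a (p * (n / p)) / (primeDivisorsIn P Q (p * (n / p)) : ℂ)‖ ≤ 1 := by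
  set F := (Pr[P, Q]).filter (fun p => p ∣ n ∧ n / p ∈ (Aa[X, p]).filter (fun m => p ∣ m))
    with hF
  have hcongr : ∀ p ∈ F, a (p * (n / p)) / (primeDivisorsIn P Q (p * (n / p)) : ℂ) =
      a n / (primeDivisorsIn P Q n : ℂ) := by
    intro p hp
    rw [Nat.mul_div_cancel' (mem_filter.1 hp).2.1]
  have hsub : F ⊆ (Pr[P, Q]).filter (· ∣ n) := by
    intro p hp
    rw [mem_filter] at hp ⊢
    exact ⟨hp.1, hp.2.1⟩
  rcases F.eq_empty_or_nonempty with hE | hne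
  · rw [hE, sum_empty, norm_zero]
    exact zero_le_one
  have hω : 0 < primeDivisorsIn P Q n := by
    rw [primeDivisorsIn_eq]
    exact card_pos.2 (hne.mono hsub)
  have hωC : (primeDivisorsIn P Q n : ℝ) ≠ 0 := by exact_mod_cast hω.ne'
  rw [sum_congr rfl hcongr, sum_const, nsmul_eq_mul, norm_mul, norm_div, Complex.norm_natCast,
    Complex.norm_natCast]
  calc (#F : ℝ) * (‖a n‖ / (primeDivisorsIn P Q n : ℝ))
      ≤ (primeDivisorsIn P Q n : ℝ) * (‖a n‖ / (primeDivisorsIn P Q n : ℝ)) := by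
        gcongr
        rw [primeDivisorsIn_eq]
        exact_mod_cast card_le_card hsub
    _ = ‖a n‖ := by field_simp
    _ ≤ 1 := ha n

/-- The block of `p`: with `j = ⌊H log p⌋`, `1 ≤ p e^{-j/H} < e^{1/H}`. [folklore] -/
theorem block_bounds {H : ℝ} (hH : 0 < H) {p : ℕ} (hp : 1 ≤ p) :
    1 ≤ (p : ℝ) * Real.exp (-((⌊H * Real.log p⌋₊ : ℕ) / H)) ∧
      (p : ℝ) * Real.exp (-((⌊H * Real.log p⌋₊ : ℕ) / H)) < Real.exp (1 / H) := by
  obtain ⟨h1, h2⟩ := (block_iff hH hp _).2 rfl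
  constructor
  · have : Real.exp ((⌊H * Real.log p⌋₊ : ℕ) / H) * Real.exp (-((⌊H * Real.log p⌋₊ : ℕ) / H)) = 1 := by
      rw [← Real.exp_add]; simp
    rw [← this]
    exact mul_le_mul_of_nonneg_right h1 (Real.exp_pos _).le
  · have : Real.exp (((⌊H * Real.log p⌋₊ : ℕ) + 1) / H) * Real.exp (-((⌊H * Real.log p⌋₊ : ℕ) / H)) =
        Real.exp (1 / H) := by
      rw [← Real.exp_add]; congr 1; ring
    rw [← this]
    exact mul_lt_mul_of_pos_right h2 (Real.exp_pos _)

/-- Support of `E1`/`E2`: `n ∈ [X, 2X]` with `p² ∣ n` for some `p ∈ 𝒫`. [folklore] -/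
theorem supp_E12 {X : ℝ} (P Q : ℝ) (N' : ℕ) :
    ∀ n ∈ Icc 1 N', ∀ p ∈ Pr[P, Q], p ∣ n → n / p ∈ (Aa[X, p]).filter (fun m => p ∣ m) →
      (n ∈ Nn[X] ∧ ∃ q ∈ Pr[P, Q], q ^ 2 ∣ n) := by
  intro n _ p hp hpn hm
  rw [mem_filter, mem_filter, Nat.mul_div_cancel' hpn] at hm
  refine ⟨hm.1.2, p, hp, ?_⟩
  have := Nat.mul_dvd_mul_left p hm.2
  rwa [Nat.mul_div_cancel' hpn, ← sq] at this

/-- Support of `E3a`: `n ∈ [X, 2X]` and `n < e^{1/H} X`. [folklore] -/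
theorem supp_E3a {X H : ℝ} (hX : 0 < X) (hH : 0 < H) (P Q : ℝ) (N' : ℕ) :
    ∀ n ∈ Icc 1 N', ∀ p ∈ Pr[P, Q], p ∣ n → n / p ∈ Aa[X, p] \ Mm[X, H, ⌊H * Real.log p⌋₊] →
      (n ∈ Nn[X] ∧ (n : ℝ) < Real.exp (1 / H) * X) := by
  intro n _ p hp hpn hm
  rw [mem_sdiff, mem_filter, Nat.mul_div_cancel' hpn] at hm
  obtain ⟨⟨_, hnN⟩, hnot⟩ := hm
  refine ⟨hnN, ?_⟩
  have hp1 : 1 ≤ p := (mem_filter.1 hp).2.one_lt.le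
  obtain ⟨hb1, hb2⟩ := block_bounds hH hp1
  set E := Real.exp (-((⌊H * Real.log p⌋₊ : ℕ) / H)) with hE
  have hE0 : 0 < E := Real.exp_pos _
  have hn_eq : (n : ℝ) = p * (n / p : ℕ) := by exact_mod_cast (Nat.mul_div_cancel' hpn).symm
  rw [mem_Icc, not_and_or, not_le, not_le] at hnot
  rcases hnot with h | h
  · -- `m < ⌈X E⌉`, so `m < X E` and `n = p m < p X E < e^{1/H} X`
    have hm : ((n / p : ℕ) : ℝ) < X * E := Nat.lt_ceil.1 h
    calc (n : ℝ) = p * (n / p : ℕ) := hn_eq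
      _ < p * (X * E) := by
          have hp0 : (0 : ℝ) < p := by exact_mod_cast hp1
          exact mul_lt_mul_of_pos_left hm hp0
      _ = (p * E) * X := by ring
      _ < Real.exp (1 / H) * X := mul_lt_mul_of_pos_right hb2 hX
  · -- `m > ⌊2 X E⌋`, so `n = p m > 2X`, contradicting `n ∈ [X, 2X]`
    exfalso
    have hm : 2 * X * E < ((n / p : ℕ) : ℝ) := (Nat.floor_lt (by positivity)).1 h
    have hn2 : (n : ℝ) ≤ 2 * X := (Nat.le_floor_iff (by positivity)).1 (mem_Icc.1 hnN).2
    have : 2 * X < (n : ℝ) :=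
      calc 2 * X ≤ 2 * X * (p * E) := le_mul_of_one_le_right (by positivity) hb1
        _ = p * (2 * X * E) := by ring
        _ < p * ((n / p : ℕ) : ℝ) := by
            have hp0 : (0 : ℝ) < p := by exact_mod_cast hp1
            exact mul_lt_mul_of_pos_left hm hp0
        _ = n := hn_eq.symm
    linarith

/-- Support of `E3b`: `2X < n ≤ 2 e^{1/H} X`. [folklore] -/
theorem supp_E3b {X H : ℝ} (hX : 0 < X) (hH : 0 < H) (P Q : ℝ) (N' : ℕ) :
    ∀ n ∈ Icc 1 N', ∀ p ∈ Pr[P, Q], p ∣ n → n / p ∈ Mm[X, H, ⌊H * Real.log p⌋₊] \ Aa[X, p] →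
      (2 * X < (n : ℝ) ∧ (n : ℝ) ≤ 2 * Real.exp (1 / H) * X) := by
  intro n _ p hp hpn hm
  rw [mem_sdiff, mem_Icc] at hm
  obtain ⟨⟨hm1, hm2⟩, hnot⟩ := hm
  have hp1 : 1 ≤ p := (mem_filter.1 hp).2.one_lt.le
  have hp0 : (0 : ℝ) < p := by exact_mod_cast hp1
  obtain ⟨hb1, hb2⟩ := block_bounds hH hp1
  set E := Real.exp (-((⌊H * Real.log p⌋₊ : ℕ) / H)) with hE
  have hE0 : 0 < E := Real.exp_pos _
  have hn_eq : (n : ℝ) = p * (n / p : ℕ) := by exact_mod_cast (Nat.mul_div_cancel' hpn).symm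
  have hmlo : X * E ≤ ((n / p : ℕ) : ℝ) := Nat.ceil_le.1 hm1
  have hmhi : ((n / p : ℕ) : ℝ) ≤ 2 * X * E := (Nat.le_floor_iff (by positivity)).1 hm2
  have hnX : X ≤ n :=
    calc X ≤ X * (p * E) := le_mul_of_one_le_right hX.le hb1
      _ = p * (X * E) := by ring
      _ ≤ p * ((n / p : ℕ) : ℝ) := mul_le_mul_of_nonneg_left hmlo hp0.le
      _ = n := hn_eq.symm
  constructor
  · by_contra hle
    push Not at hle
    apply hnot
    rw [mem_filter, mem_Icc, Nat.mul_div_cancel' hpn, mem_Icc]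
    have hnM : n ≤ ⌊2 * X⌋₊ := (Nat.le_floor_iff (by positivity)).2 hle
    refine ⟨⟨?_, (Nat.div_le_self n p).trans hnM⟩, Nat.ceil_le.2 hnX, hnM⟩
    exact Nat.one_le_iff_ne_zero.2 fun h0 => by
      rw [h0, Nat.cast_zero] at hmlo
      have : 0 < X * E := by positivity
      linarith
  · calc (n : ℝ) = p * (n / p : ℕ) := hn_eq
      _ ≤ p * (2 * X * E) := mul_le_mul_of_nonneg_left hmhi hp0.le
      _ = 2 * (p * E) * X := by ring
      _ ≤ 2 * Real.exp (1 / H) * X := by gcongr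

/-- Mean value of a Dirichlet polynomial supported on `s ⊆ [1, N']`. [folklore] -/
theorem meanvalue_subset (s : Finset ℕ) (N' : ℕ) (hs : s ⊆ Icc 1 N') (d : ℕ → ℂ) {T : ℝ}
    (hT : 0 < T) {𝒯 : Set ℝ} (h𝒯 : 𝒯 ⊆ Set.Icc (-T) T) :
    ∫ t in 𝒯, ‖∑ n ∈ s, d n * cw[t, n]‖ ^ 2 ≤
      (5 * T + 18 * N') * ∑ n ∈ s, ‖d n‖ ^ 2 / (n : ℝ) ^ 2 := by
  classical
  have h1 : ∀ t : ℝ, ∑ n ∈ s, d n * cw[t, n] =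
      ∑ n ∈ Icc 1 N', (if n ∈ s then d n else 0) * cw[t, n] := by
    intro t
    rw [← sum_subset hs (fun n _ hns => by rw [if_neg hns, zero_mul])]
    exact sum_congr rfl fun n hn => by rw [if_pos hn]
  have h2 : ∑ n ∈ Icc 1 N', ‖(if n ∈ s then d n else 0)‖ ^ 2 / (n : ℝ) ^ 2 =
      ∑ n ∈ s, ‖d n‖ ^ 2 / (n : ℝ) ^ 2 := by
    rw [← sum_subset hs (fun n _ hns => by rw [if_neg hns]; simp)]
    exact sum_congr rfl fun n hn => by rw [if_pos hn]
  simp_rw [h1]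
  rw [← h2]
  exact meanvalue _ N' hT h𝒯

/-- Cauchy–Schwarz under the integral for the main term:
`∫_𝒯 |∑_j Q_j R_j|² ≤ #ℐ ∑_j ∫_𝒯 |Q_j R_j|²`. [folklore] -/
theorem integral_main_le (ℐ : Finset ℕ) (F : ℕ → ℝ → ℂ) (hF : ∀ j, Continuous (F j)) {T : ℝ}
    {𝒯 : Set ℝ} (h𝒯 : 𝒯 ⊆ Set.Icc (-T) T) :
    ∫ t in 𝒯, ‖∑ j ∈ ℐ, F j t‖ ^ 2 ≤ #ℐ * ∑ j ∈ ℐ, ∫ t in 𝒯, ‖F j t‖ ^ 2 := by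
  have hint : ∀ j, IntegrableOn (fun t => ‖F j t‖ ^ 2) 𝒯 := fun j =>
    integrableOn_of_continuous ((hF j).norm.pow 2) h𝒯
  calc ∫ t in 𝒯, ‖∑ j ∈ ℐ, F j t‖ ^ 2 ≤ ∫ t in 𝒯, #ℐ * ∑ j ∈ ℐ, ‖F j t‖ ^ 2 := by
        refine integral_mono_of_nonneg (Filter.Eventually.of_forall fun t => by positivity) ?_
          (Filter.Eventually.of_forall fun t => norm_sq_sum_le ℐ fun j => F j t)
        exact (integrable_finsetSum ℐ fun j _ => hint j).const_mul _
    _ = #ℐ * ∑ j ∈ ℐ, ∫ t in 𝒯, ‖F j t‖ ^ 2 := by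
        rw [integral_const_mul, integral_finsetSum ℐ fun j _ => hint j]


/-- Integrating a pointwise six-term bound `|f|² ≤ 6 (|g₁|² + ⋯ + |g₆|²)` over `𝒯`. [folklore] -/
theorem integral_six_le {T : ℝ} {𝒯 : Set ℝ} (h𝒯 : 𝒯 ⊆ Set.Icc (-T) T)
    (f g₁ g₂ g₃ g₄ g₅ g₆ : ℝ → ℂ) (h₁ : Continuous g₁) (h₂ : Continuous g₂) (h₃ : Continuous g₃)
    (h₄ : Continuous g₄) (h₅ : Continuous g₅) (h₆ : Continuous g₆)
    (hpt : ∀ t, ‖f t‖ ^ 2 ≤ 6 * (‖g₁ t‖ ^ 2 + ‖g₂ t‖ ^ 2 + ‖g₃ t‖ ^ 2 + ‖g₄ t‖ ^ 2 +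
      ‖g₅ t‖ ^ 2 + ‖g₆ t‖ ^ 2)) :
    ∫ t in 𝒯, ‖f t‖ ^ 2 ≤ 6 * ((∫ t in 𝒯, ‖g₁ t‖ ^ 2) + (∫ t in 𝒯, ‖g₂ t‖ ^ 2) +
      (∫ t in 𝒯, ‖g₃ t‖ ^ 2) + (∫ t in 𝒯, ‖g₄ t‖ ^ 2) + (∫ t in 𝒯, ‖g₅ t‖ ^ 2) +
      ∫ t in 𝒯, ‖g₆ t‖ ^ 2) := by
  have i₁ : Integrable (fun t => ‖g₁ t‖ ^ 2) (volume.restrict 𝒯) :=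
    integrableOn_of_continuous (h₁.norm.pow 2) h𝒯
  have i₂ : Integrable (fun t => ‖g₂ t‖ ^ 2) (volume.restrict 𝒯) :=
    integrableOn_of_continuous (h₂.norm.pow 2) h𝒯
  have i₃ : Integrable (fun t => ‖g₃ t‖ ^ 2) (volume.restrict 𝒯) :=
    integrableOn_of_continuous (h₃.norm.pow 2) h𝒯
  have i₄ : Integrable (fun t => ‖g₄ t‖ ^ 2) (volume.restrict 𝒯) :=
    integrableOn_of_continuous (h₄.norm.pow 2) h𝒯
  have i₅ : Integrable (fun t => ‖g₅ t‖ ^ 2) (volume.restrict 𝒯) :=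
    integrableOn_of_continuous (h₅.norm.pow 2) h𝒯
  have i₆ : Integrable (fun t => ‖g₆ t‖ ^ 2) (volume.restrict 𝒯) :=
    integrableOn_of_continuous (h₆.norm.pow 2) h𝒯
  have i₁₂ : Integrable (fun t => ‖g₁ t‖ ^ 2 + ‖g₂ t‖ ^ 2) (volume.restrict 𝒯) := i₁.add i₂
  have i₁₂₃ : Integrable (fun t => ‖g₁ t‖ ^ 2 + ‖g₂ t‖ ^ 2 + ‖g₃ t‖ ^ 2) (volume.restrict 𝒯) :=
    i₁₂.add i₃
  have i₁₂₃₄ : Integrable (fun t => ‖g₁ t‖ ^ 2 + ‖g₂ t‖ ^ 2 + ‖g₃ t‖ ^ 2 + ‖g₄ t‖ ^ 2)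
      (volume.restrict 𝒯) := i₁₂₃.add i₄
  have i₁₂₃₄₅ : Integrable (fun t => ‖g₁ t‖ ^ 2 + ‖g₂ t‖ ^ 2 + ‖g₃ t‖ ^ 2 + ‖g₄ t‖ ^ 2 +
      ‖g₅ t‖ ^ 2) (volume.restrict 𝒯) := i₁₂₃₄.add i₅
  have iall : Integrable (fun t => 6 * (‖g₁ t‖ ^ 2 + ‖g₂ t‖ ^ 2 + ‖g₃ t‖ ^ 2 + ‖g₄ t‖ ^ 2 +
      ‖g₅ t‖ ^ 2 + ‖g₆ t‖ ^ 2)) (volume.restrict 𝒯) := (i₁₂₃₄₅.add i₆).const_mul 6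
  calc ∫ t in 𝒯, ‖f t‖ ^ 2 ≤ ∫ t in 𝒯, 6 * (‖g₁ t‖ ^ 2 + ‖g₂ t‖ ^ 2 + ‖g₃ t‖ ^ 2 +
        ‖g₄ t‖ ^ 2 + ‖g₅ t‖ ^ 2 + ‖g₆ t‖ ^ 2) :=
        integral_mono_of_nonneg (Filter.Eventually.of_forall fun t => by positivity) iall
          (Filter.Eventually.of_forall hpt)
    _ = _ := by
        rw [integral_const_mul, integral_add i₁₂₃₄₅ i₆, integral_add i₁₂₃₄ i₅,
          integral_add i₁₂₃ i₄, integral_add i₁₂ i₃, integral_add i₁ i₂]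

/-- Integrating a pointwise two-term bound `|f|² ≤ 2 (|g₁|² + |g₂|²)` over `𝒯`. [folklore] -/
theorem integral_two_le {T : ℝ} {𝒯 : Set ℝ} (h𝒯 : 𝒯 ⊆ Set.Icc (-T) T) (f g₁ g₂ : ℝ → ℂ)
    (h₁ : Continuous g₁) (h₂ : Continuous g₂)
    (hpt : ∀ t, ‖f t‖ ^ 2 ≤ 2 * (‖g₁ t‖ ^ 2 + ‖g₂ t‖ ^ 2)) :
    ∫ t in 𝒯, ‖f t‖ ^ 2 ≤ 2 * ((∫ t in 𝒯, ‖g₁ t‖ ^ 2) + ∫ t in 𝒯, ‖g₂ t‖ ^ 2) := by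
  have i₁ : Integrable (fun t => ‖g₁ t‖ ^ 2) (volume.restrict 𝒯) :=
    integrableOn_of_continuous (h₁.norm.pow 2) h𝒯
  have i₂ : Integrable (fun t => ‖g₂ t‖ ^ 2) (volume.restrict 𝒯) :=
    integrableOn_of_continuous (h₂.norm.pow 2) h𝒯
  have iall : Integrable (fun t => 2 * (‖g₁ t‖ ^ 2 + ‖g₂ t‖ ^ 2)) (volume.restrict 𝒯) :=
    (i₁.add i₂).const_mul 2
  calc ∫ t in 𝒯, ‖f t‖ ^ 2 ≤ ∫ t in 𝒯, 2 * (‖g₁ t‖ ^ 2 + ‖g₂ t‖ ^ 2) :=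
        integral_mono_of_nonneg (Filter.Eventually.of_forall fun t => by positivity) iall
          (Filter.Eventually.of_forall hpt)
    _ = _ := by rw [integral_const_mul, integral_add i₁ i₂]


/-! ### Assembly -/

/-- `#(Pr[P, Q]) ≤ Q - P + 1`. [folklore] -/
theorem card_Pr_le {P Q : ℝ} (hP : 0 ≤ P) (hPQ : P ≤ Q) : (#(Pr[P, Q]) : ℝ) ≤ Q - P + 1 := by
  calc (#(Pr[P, Q]) : ℝ) ≤ #(Icc ⌈P⌉₊ ⌊Q⌋₊) := by exact_mod_cast card_filter_le _ _
    _ = ((⌊Q⌋₊ + 1 - ⌈P⌉₊ : ℕ) : ℝ) := by rw [Nat.card_Icc]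
    _ ≤ Q - P + 1 := by
        rcases le_or_gt ⌈P⌉₊ (⌊Q⌋₊ + 1) with h | h
        · rw [Nat.cast_sub h]
          push_cast
          linarith [Nat.floor_le (hP.trans hPQ), Nat.le_ceil P]
        · rw [Nat.sub_eq_zero_of_le h.le]
          push_cast
          linarith

/-- Cardinality of a window `Ico A B` in real terms: `#(Ico ⌈u⌉ ⌈v⌉) ≤ v - u + 1` for `0 ≤ u ≤ v`.
[folklore] -/
theorem card_Ico_ceil_le {u v : ℝ} (hu : 0 ≤ u) (huv : u ≤ v) :
    (#(Ico ⌈u⌉₊ ⌈v⌉₊) : ℝ) ≤ v - u + 1 := by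
  rw [Nat.card_Ico]
  rcases le_or_gt ⌈u⌉₊ ⌈v⌉₊ with h | h
  · rw [Nat.cast_sub h]
    linarith [Nat.ceil_lt_add_one (hu.trans huv), Nat.le_ceil u]
  · rw [Nat.sub_eq_zero_of_le h.le]
    push_cast
    linarith

/-- `#(Ioc ⌊u⌋ ⌊v⌋) ≤ v - u + 1` for `0 ≤ u ≤ v`. [folklore] -/
theorem card_Ioc_floor_le {u v : ℝ} (hu : 0 ≤ u) (huv : u ≤ v) :
    (#(Ioc ⌊u⌋₊ ⌊v⌋₊) : ℝ) ≤ v - u + 1 := by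
  rw [Nat.card_Ioc]
  rcases le_or_gt ⌊u⌋₊ ⌊v⌋₊ with h | h
  · rw [Nat.cast_sub h]
    linarith [Nat.floor_le (hu.trans huv), Nat.lt_floor_add_one u]
  · rw [Nat.sub_eq_zero_of_le h.le]
    push_cast
    linarith

set_option maxHeartbeats 400000 in
/-- **Matomäki–Radziwiłł 2016, Lemma 12**, with the explicit absolute constant `C = 20000` (hypotheses
as in `MatomakiRadziwill2016_lemma12`; the measurability of `𝒯` is not needed).
[cite: MatomakiRadziwillAnnals2016, Lemma 12] -/
theorem lemma12_bound (X T P Q H : ℝ) (a b c : ℕ → ℂ) (𝒯 : Set ℝ) (hX : 1 ≤ X) (hT : 1 ≤ T)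
    (hP : 1 ≤ P) (hPQ : P ≤ Q) (hH : 1 ≤ H) (ha : ∀ n, ‖a n‖ ≤ 1) (hb : ∀ m, ‖b m‖ ≤ 1)
    (hc : ∀ p, ‖c p‖ ≤ 1)
    (hfac : ∀ m p : ℕ, p.Prime → P ≤ p → (p : ℝ) ≤ Q → ¬ p ∣ m → a (m * p) = b m * c p)
    (h𝒯 : 𝒯 ⊆ Set.Icc (-T) T) :
    ∫ t in 𝒯, ‖∑ n ∈ Icc ⌈X⌉₊ ⌊2 * X⌋₊, a n * (n : ℂ) ^ (-(1 + (t : ℂ) * I))‖ ^ 2 ≤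
      20000 * ((H * Real.log (Q / P)) *
              (∑ j ∈ Icc ⌊H * Real.log P⌋₊ ⌊H * Real.log Q⌋₊,
                ∫ t in 𝒯, ‖blockPrimePoly c P Q H j t * blockCofactorPoly b X P Q H j t‖ ^ 2)
            + (T + X) / X * (1 / H + 1 / P
                + ∑ n ∈ (Icc ⌈X⌉₊ ⌊2 * X⌋₊).filter
                    (fun n : ℕ => ∀ p ∈ (Icc ⌈P⌉₊ ⌊Q⌋₊).filter Nat.Prime, ¬ p ∣ n),
                    ‖a n‖ ^ 2 / n)) := by
  -- positivity bookkeeping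
  have hX0 : 0 < X := by linarith
  have hT0 : 0 < T := by linarith
  have hP0 : 0 < P := by linarith
  have hH0 : 0 < H := by linarith
  have hQ0 : 0 ≤ Q := by linarith
  have hQpos : 0 < Q := by linarith
  have hXne : X ≠ 0 := hX0.ne'
  have hPne : P ≠ 0 := hP0.ne'
  have hHne : H ≠ 0 := hH0.ne'
  have hM : (⌊2 * X⌋₊ : ℝ) ≤ 2 * X := Nat.floor_le (by positivity)
  have hR0 : 5 * T + 18 * (⌊2 * X⌋₊ : ℝ) ≤ 36 * (T + X) := by linarith
  have hPs0 : ∀ p ∈ Pr[P, Q], 0 < p := fun p hp => (mem_filter.1 hp).2.pos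
  have hH1 : 1 / H ≤ 1 := (div_le_one hH0).2 hH
  have he1 : 1 ≤ Real.exp (1 / H) := Real.one_le_exp (by positivity)
  have he3 : Real.exp (1 / H) ≤ 3 :=
    ((Real.exp_le_exp.2 hH1).trans Real.exp_one_lt_d9.le).trans (by norm_num)
  have heH : Real.exp (1 / H) - 1 ≤ 2 / H := by
    -- `|e^x - 1| ≤ 2|x|` for `|x| ≤ 1` (`Real.abs_exp_sub_one_le`)
    have h0 : (0 : ℝ) ≤ 1 / H := by positivity
    have := Real.abs_exp_sub_one_le (x := 1 / H) (by rw [abs_of_nonneg h0]; exact hH1)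
    rw [abs_of_nonneg h0] at this
    linarith only [this, le_abs_self (Real.exp (1 / H) - 1), show 2 * (1 / H) = 2 / H from by ring]
  have hL0 : 0 ≤ H * Real.log (Q / P) :=
    mul_nonneg hH0.le (Real.log_nonneg ((one_le_div hP0).2 hPQ))
  have hScop0 : 0 ≤ ∑ n ∈ (Nn[X]).filter (fun n => ∀ p ∈ Pr[P, Q], ¬ p ∣ n),
      ‖a n‖ ^ 2 / (n : ℝ) := sum_nonneg fun n _ => by positivity
  have hSmain0 : 0 ≤ ∑ j ∈ Icc ⌊H * Real.log P⌋₊ ⌊H * Real.log Q⌋₊,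
      ∫ t in 𝒯, ‖blockPrimePoly c P Q H j t * blockCofactorPoly b X P Q H j t‖ ^ 2 :=
    sum_nonneg fun j _ => integral_nonneg fun t => by positivity
  have hNn1 : ∀ n ∈ Nn[X], X ≤ n := fun n hn => Nat.ceil_le.1 (mem_Icc.1 hn).1
  -- continuity of all the pieces
  have cQ : ∀ j, Continuous (blockPrimePoly c P Q H j) := fun j => by
    unfold blockPrimePoly; exact continuous_dsum _ _
  have cR : ∀ j, Continuous (blockCofactorPoly b X P Q H j) := fun j => by
    unfold blockCofactorPoly
    exact continuous_finsetSum _ fun m _ => (continuous_const.mul (continuous_cpw m)).div_const _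
  have cMain : Continuous fun t : ℝ => ∑ j ∈ Icc ⌊H * Real.log P⌋₊ ⌊H * Real.log Q⌋₊,
      blockPrimePoly c P Q H j t * blockCofactorPoly b X P Q H j t :=
    continuous_finsetSum _ fun j _ => (cQ j).mul (cR j)
  have cE3a := continuous_pairs (Pr[P, Q]) (fun p => Aa[X, p] \ Mm[X, H, ⌊H * Real.log p⌋₊])
    (fun p m => c p * b m * wt[P, Q, m])
  have cE3b := continuous_pairs (Pr[P, Q]) (fun p => Mm[X, H, ⌊H * Real.log p⌋₊] \ Aa[X, p])
    (fun p m => c p * b m * wt[P, Q, m])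
  have cE2 := continuous_pairs (Pr[P, Q]) (fun p => (Aa[X, p]).filter (fun m => p ∣ m))
    (fun p m => c p * b m * wt[P, Q, m])
  have cE1 := continuous_pairs (Pr[P, Q]) (fun p => (Aa[X, p]).filter (fun m => p ∣ m))
    (fun p m => a (p * m) / (primeDivisorsIn P Q (p * m) : ℂ))
  have cCop : Continuous fun t : ℝ =>
      ∑ n ∈ (Nn[X]).filter (fun n => ∀ p ∈ Pr[P, Q], ¬ p ∣ n), a n * cw[t, n] :=
    continuous_dsum _ _
  beta_reduce at cE3a cE3b cE2 cE1
  -- pointwise decomposition and the six-term inequality, integrated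
  have hpt := fun t : ℝ =>
    (congrArg (fun z : ℂ => ‖z‖ ^ 2) (decomposition hX0 hP hPQ hH0 a b c hfac t)).trans_le
      (norm_sq_six_le _ _ _ _ _ _)
  beta_reduce at hpt
  have step1 := integral_six_le h𝒯 _ _ _ _ _ _ _ cMain cE3a cE3b cE2 cE1 cCop hpt
  beta_reduce at step1
  -- the main term
  have IMain := integral_main_le (Icc ⌊H * Real.log P⌋₊ ⌊H * Real.log Q⌋₊)
    (fun j t => blockPrimePoly c P Q H j t * blockCofactorPoly b X P Q H j t)
    (fun j => (cQ j).mul (cR j)) h𝒯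
  beta_reduce at IMain
  have hI := card_blocks_le hH0.le hP hPQ
  -- E1 and E2: supported on `n ∈ [X,2X]` with `p² ∣ n`
  have hS12 : ∀ p ∈ Pr[P, Q], ∀ m ∈ (Aa[X, p]).filter (fun m => p ∣ m),
      1 ≤ m ∧ p * m ≤ ⌊2 * X⌋₊ := by
    intro p _ m hm
    rw [mem_filter, mem_filter, mem_Icc, mem_Icc] at hm
    exact ⟨hm.1.1.1, hm.1.2.2⟩
  have hcount12 : (#((Icc 1 ⌊2 * X⌋₊).filter
      (fun n : ℕ => n ∈ Nn[X] ∧ ∃ q ∈ Pr[P, Q], q ^ 2 ∣ n)) : ℝ) ≤ 4 * X / P := by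
    calc (#((Icc 1 ⌊2 * X⌋₊).filter (fun n : ℕ => n ∈ Nn[X] ∧ ∃ q ∈ Pr[P, Q], q ^ 2 ∣ n)) : ℝ)
        ≤ #((Icc 1 ⌊2 * X⌋₊).filter (fun n => ∃ q ∈ Pr[P, Q], q ^ 2 ∣ n)) := by
          exact_mod_cast card_le_card (fun n hn => by
            rw [mem_filter] at hn ⊢; exact ⟨hn.1, hn.2.2⟩)
      _ ≤ ∑ q ∈ Pr[P, Q], (⌊2 * X⌋₊ : ℝ) / (q : ℝ) ^ 2 := card_filter_exists_sq_dvd_le _ _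
      _ = (⌊2 * X⌋₊ : ℝ) * ∑ q ∈ Pr[P, Q], ((q : ℝ) ^ 2)⁻¹ := by
          rw [mul_sum]; exact sum_congr rfl fun q _ => by rw [div_eq_mul_inv]
      _ ≤ (⌊2 * X⌋₊ : ℝ) * ∑ k ∈ Icc ⌈P⌉₊ ⌊Q⌋₊, ((k : ℝ) ^ 2)⁻¹ :=
          mul_le_mul_of_nonneg_left
            (sum_le_sum_of_subset_of_nonneg (filter_subset _ _) fun _ _ _ => by positivity)
            (by positivity)
      _ ≤ (2 * X) * (2 / P) := by
          gcongr
          exact sum_Icc_inv_sq_le hP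
      _ = 4 * X / P := by ring
  have IE1 := pairs_meanvalue (Pr[P, Q]) hPs0 (fun p => (Aa[X, p]).filter (fun m => p ∣ m))
    ⌊2 * X⌋₊ hS12 (fun p m => a (p * m) / (primeDivisorsIn P Q (p * m) : ℂ)) hT0 h𝒯 _
    (coeff_sq_le_indicator (Pr[P, Q]) (fun p => (Aa[X, p]).filter (fun m => p ∣ m))
      (fun p m => a (p * m) / (primeDivisorsIn P Q (p * m) : ℂ)) ⌊2 * X⌋₊
      (fun n : ℕ => n ∈ Nn[X] ∧ ∃ q ∈ Pr[P, Q], q ^ 2 ∣ n)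
      (fun n _ => coeff_E1_le P Q ha n) (supp_E12 P Q ⌊2 * X⌋₊))
  have IE2 := pairs_meanvalue (Pr[P, Q]) hPs0 (fun p => (Aa[X, p]).filter (fun m => p ∣ m))
    ⌊2 * X⌋₊ hS12 (fun p m => c p * b m * wt[P, Q, m]) hT0 h𝒯 _
    (coeff_sq_le_indicator (Pr[P, Q]) (fun p => (Aa[X, p]).filter (fun m => p ∣ m))
      (fun p m => c p * b m * wt[P, Q, m]) ⌊2 * X⌋₊
      (fun n : ℕ => n ∈ Nn[X] ∧ ∃ q ∈ Pr[P, Q], q ^ 2 ∣ n)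
      (fun n _ => coeff_wt_le P Q hb hc (fun p => (Aa[X, p]).filter (fun m => p ∣ m)) n)
      (supp_E12 P Q ⌊2 * X⌋₊))
  beta_reduce at IE1 IE2
  have hsum12 : ∑ n ∈ Icc 1 ⌊2 * X⌋₊,
      (if (n ∈ Nn[X] ∧ ∃ q ∈ Pr[P, Q], q ^ 2 ∣ n) then (1 : ℝ) else 0) / (n : ℝ) ^ 2 ≤
        (4 * X / P) / X ^ 2 :=
    (sum_indicator_div_sq_le _ _ hX0 (fun n _ h => hNn1 n h.1)).trans
      (div_le_div_of_nonneg_right hcount12 (by positivity))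
  have IE1' : ∫ t in 𝒯, ‖∑ p ∈ Pr[P, Q], ∑ m ∈ (Aa[X, p]).filter (fun m => p ∣ m),
      a (p * m) / (primeDivisorsIn P Q (p * m) : ℂ) * cw[t, p * m]‖ ^ 2 ≤
        144 * ((T + X) / X) * (1 / P) :=
    calc _ ≤ (5 * T + 18 * (⌊2 * X⌋₊ : ℝ)) * ((4 * X / P) / X ^ 2) :=
          IE1.trans (mul_le_mul_of_nonneg_left hsum12 (by positivity))
      _ ≤ (36 * (T + X)) * ((4 * X / P) / X ^ 2) := mul_le_mul_of_nonneg_right hR0 (by positivity)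
      _ = 144 * ((T + X) / X) * (1 / P) := by field_simp; ring
  have IE2' : ∫ t in 𝒯, ‖∑ p ∈ Pr[P, Q], ∑ m ∈ (Aa[X, p]).filter (fun m => p ∣ m),
      c p * b m * wt[P, Q, m] * cw[t, p * m]‖ ^ 2 ≤ 144 * ((T + X) / X) * (1 / P) :=
    calc _ ≤ (5 * T + 18 * (⌊2 * X⌋₊ : ℝ)) * ((4 * X / P) / X ^ 2) :=
          IE2.trans (mul_le_mul_of_nonneg_left hsum12 (by positivity))
      _ ≤ (36 * (T + X)) * ((4 * X / P) / X ^ 2) := mul_le_mul_of_nonneg_right hR0 (by positivity)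
      _ = 144 * ((T + X) / X) * (1 / P) := by field_simp; ring
  -- the coprime part
  have hcopsub : (Nn[X]).filter (fun n => ∀ p ∈ Pr[P, Q], ¬ p ∣ n) ⊆ Icc 1 ⌊2 * X⌋₊ :=
    (filter_subset _ _).trans (Nn_subset hX0)
  have ICop : ∫ t in 𝒯, ‖∑ n ∈ (Nn[X]).filter (fun n => ∀ p ∈ Pr[P, Q], ¬ p ∣ n),
      a n * cw[t, n]‖ ^ 2 ≤ 36 * ((T + X) / X) *
        ∑ n ∈ (Nn[X]).filter (fun n => ∀ p ∈ Pr[P, Q], ¬ p ∣ n), ‖a n‖ ^ 2 / (n : ℝ) := by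
    refine (meanvalue_subset _ _ hcopsub a hT0 h𝒯).trans ?_
    have hterm : ∀ n ∈ (Nn[X]).filter (fun n => ∀ p ∈ Pr[P, Q], ¬ p ∣ n),
        ‖a n‖ ^ 2 / (n : ℝ) ^ 2 ≤ (1 / X) * (‖a n‖ ^ 2 / (n : ℝ)) := by
      intro n hn
      have hXn : X ≤ n := hNn1 n (mem_filter.1 hn).1
      have hn0 : (0 : ℝ) < n := hX0.trans_le hXn
      rw [div_mul_div_comm, one_mul]
      exact div_le_div_of_nonneg_left (by positivity) (by positivity)
        (by rw [sq]; exact mul_le_mul_of_nonneg_right hXn hn0.le)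
    calc (5 * T + 18 * (⌊2 * X⌋₊ : ℝ)) *
          ∑ n ∈ (Nn[X]).filter (fun n => ∀ p ∈ Pr[P, Q], ¬ p ∣ n), ‖a n‖ ^ 2 / (n : ℝ) ^ 2
        ≤ (36 * (T + X)) * ((1 / X) *
          ∑ n ∈ (Nn[X]).filter (fun n => ∀ p ∈ Pr[P, Q], ¬ p ∣ n), ‖a n‖ ^ 2 / (n : ℝ)) := by
          rw [mul_sum (Finset.filter _ _) _ (1 / X)]
          exact mul_le_mul hR0 (sum_le_sum hterm) (sum_nonneg fun n _ => by positivity)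
            (by positivity)
      _ = _ := by ring
  -- E3a: supported on `[X, e^{1/H} X)`
  have hS3a : ∀ p ∈ Pr[P, Q], ∀ m ∈ Aa[X, p] \ Mm[X, H, ⌊H * Real.log p⌋₊],
      1 ≤ m ∧ p * m ≤ ⌊2 * X⌋₊ := by
    intro p _ m hm
    rw [mem_sdiff, mem_filter, mem_Icc, mem_Icc] at hm
    exact ⟨hm.1.1.1, hm.1.2.2⟩
  have IE3a := pairs_meanvalue (Pr[P, Q]) hPs0 (fun p => Aa[X, p] \ Mm[X, H, ⌊H * Real.log p⌋₊])
    ⌊2 * X⌋₊ hS3a (fun p m => c p * b m * wt[P, Q, m]) hT0 h𝒯 _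
    (coeff_sq_le_indicator (Pr[P, Q]) (fun p => Aa[X, p] \ Mm[X, H, ⌊H * Real.log p⌋₊])
      (fun p m => c p * b m * wt[P, Q, m]) ⌊2 * X⌋₊
      (fun n : ℕ => n ∈ Nn[X] ∧ (n : ℝ) < Real.exp (1 / H) * X)
      (fun n _ => coeff_wt_le P Q hb hc (fun p => Aa[X, p] \ Mm[X, H, ⌊H * Real.log p⌋₊]) n)
      (supp_E3a hX0 hH0 P Q ⌊2 * X⌋₊))
  beta_reduce at IE3a
  have hcount3a : (#((Icc 1 ⌊2 * X⌋₊).filter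
      (fun n : ℕ => n ∈ Nn[X] ∧ (n : ℝ) < Real.exp (1 / H) * X)) : ℝ) ≤ 2 * X / H + 1 := by
    calc (#((Icc 1 ⌊2 * X⌋₊).filter (fun n : ℕ => n ∈ Nn[X] ∧ (n : ℝ) < Real.exp (1 / H) * X)) : ℝ)
        ≤ #(Ico ⌈X⌉₊ ⌈Real.exp (1 / H) * X⌉₊) := by
          exact_mod_cast card_le_card (fun n hn => by
            rw [mem_filter] at hn
            rw [mem_Ico]
            exact ⟨(mem_Icc.1 hn.2.1).1, Nat.lt_ceil.2 hn.2.2⟩)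
      _ ≤ Real.exp (1 / H) * X - X + 1 :=
          card_Ico_ceil_le hX0.le (le_mul_of_one_le_left hX0.le he1)
      _ = X * (Real.exp (1 / H) - 1) + 1 := by ring
      _ ≤ X * (2 / H) + 1 := by gcongr
      _ = 2 * X / H + 1 := by ring
  have IE3a' : ∫ t in 𝒯, ‖∑ p ∈ Pr[P, Q], ∑ m ∈ Aa[X, p] \ Mm[X, H, ⌊H * Real.log p⌋₊],
      c p * b m * wt[P, Q, m] * cw[t, p * m]‖ ^ 2 ≤
        (36 * (T + X)) * ((2 * X / H + 1) / X ^ 2) := by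
    have hsum : ∑ n ∈ Icc 1 ⌊2 * X⌋₊,
        (if (n ∈ Nn[X] ∧ (n : ℝ) < Real.exp (1 / H) * X) then (1 : ℝ) else 0) / (n : ℝ) ^ 2 ≤
          (2 * X / H + 1) / X ^ 2 :=
      (sum_indicator_div_sq_le _ _ hX0 (fun n _ h => hNn1 n h.1)).trans
        (div_le_div_of_nonneg_right hcount3a (by positivity))
    calc _ ≤ (5 * T + 18 * (⌊2 * X⌋₊ : ℝ)) * ((2 * X / H + 1) / X ^ 2) :=
          IE3a.trans (mul_le_mul_of_nonneg_left hsum (by positivity))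
      _ ≤ (36 * (T + X)) * ((2 * X / H + 1) / X ^ 2) :=
          mul_le_mul_of_nonneg_right hR0 (by positivity)
  -- E3b: supported on `(2X, 2 e^{1/H} X]`
  have hS3b : ∀ p ∈ Pr[P, Q], ∀ m ∈ Mm[X, H, ⌊H * Real.log p⌋₊] \ Aa[X, p],
      1 ≤ m ∧ p * m ≤ ⌊2 * Real.exp (1 / H) * X⌋₊ := by
    intro p hp m hm
    rw [mem_sdiff, mem_Icc] at hm
    have hp1 : 1 ≤ p := (mem_filter.1 hp).2.one_lt.le
    have hp0' : (0 : ℝ) ≤ p := by positivity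
    obtain ⟨_, hb2⟩ := block_bounds hH0 hp1
    have hpos : 0 < X * Real.exp (-((⌊H * Real.log p⌋₊ : ℕ) / H)) := by positivity
    refine ⟨(Nat.one_le_iff_ne_zero.2 (Nat.ceil_pos.2 hpos).ne').trans hm.1.1, ?_⟩
    have hm2 : (m : ℝ) ≤ 2 * X * Real.exp (-((⌊H * Real.log p⌋₊ : ℕ) / H)) :=
      (Nat.le_floor_iff (by positivity)).1 hm.1.2
    refine (Nat.le_floor_iff (by positivity)).2 ?_
    push_cast
    calc (p : ℝ) * m ≤ p * (2 * X * Real.exp (-((⌊H * Real.log p⌋₊ : ℕ) / H))) :=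
          mul_le_mul_of_nonneg_left hm2 hp0'
      _ = 2 * (p * Real.exp (-((⌊H * Real.log p⌋₊ : ℕ) / H))) * X := by ring
      _ ≤ 2 * Real.exp (1 / H) * X := by gcongr
  have IE3b := pairs_meanvalue (Pr[P, Q]) hPs0 (fun p => Mm[X, H, ⌊H * Real.log p⌋₊] \ Aa[X, p])
    ⌊2 * Real.exp (1 / H) * X⌋₊ hS3b (fun p m => c p * b m * wt[P, Q, m]) hT0 h𝒯 _
    (coeff_sq_le_indicator (Pr[P, Q]) (fun p => Mm[X, H, ⌊H * Real.log p⌋₊] \ Aa[X, p])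
      (fun p m => c p * b m * wt[P, Q, m]) ⌊2 * Real.exp (1 / H) * X⌋₊
      (fun n : ℕ => 2 * X < (n : ℝ) ∧ (n : ℝ) ≤ 2 * Real.exp (1 / H) * X)
      (fun n _ => coeff_wt_le P Q hb hc (fun p => Mm[X, H, ⌊H * Real.log p⌋₊] \ Aa[X, p]) n)
      (supp_E3b hX0 hH0 P Q ⌊2 * Real.exp (1 / H) * X⌋₊))
  beta_reduce at IE3b
  have hcount3b : (#((Icc 1 ⌊2 * Real.exp (1 / H) * X⌋₊).filter
      (fun n : ℕ => 2 * X < (n : ℝ) ∧ (n : ℝ) ≤ 2 * Real.exp (1 / H) * X)) : ℝ) ≤ 4 * X / H + 1 := by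
    calc (#((Icc 1 ⌊2 * Real.exp (1 / H) * X⌋₊).filter
          (fun n : ℕ => 2 * X < (n : ℝ) ∧ (n : ℝ) ≤ 2 * Real.exp (1 / H) * X)) : ℝ)
        ≤ #(Ioc ⌊2 * X⌋₊ ⌊2 * Real.exp (1 / H) * X⌋₊) := by
          exact_mod_cast card_le_card (fun n hn => by
            rw [mem_filter] at hn
            rw [mem_Ioc]
            exact ⟨(Nat.floor_lt (by positivity)).2 hn.2.1,
              (Nat.le_floor_iff (by positivity)).2 hn.2.2⟩)
      _ ≤ 2 * Real.exp (1 / H) * X - 2 * X + 1 :=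
          card_Ioc_floor_le (by positivity) (by nlinarith only [he1, hX0])
      _ = 2 * X * (Real.exp (1 / H) - 1) + 1 := by ring
      _ ≤ 2 * X * (2 / H) + 1 := by gcongr
      _ = 4 * X / H + 1 := by ring
  have IE3b' : ∫ t in 𝒯, ‖∑ p ∈ Pr[P, Q], ∑ m ∈ Mm[X, H, ⌊H * Real.log p⌋₊] \ Aa[X, p],
      c p * b m * wt[P, Q, m] * cw[t, p * m]‖ ^ 2 ≤
        (108 * (T + X)) * ((4 * X / H + 1) / (2 * X) ^ 2) := by
    have hsum : ∑ n ∈ Icc 1 ⌊2 * Real.exp (1 / H) * X⌋₊,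
        (if (2 * X < (n : ℝ) ∧ (n : ℝ) ≤ 2 * Real.exp (1 / H) * X) then (1 : ℝ) else 0) /
          (n : ℝ) ^ 2 ≤ (4 * X / H + 1) / (2 * X) ^ 2 :=
      (sum_indicator_div_sq_le _ _ (by positivity) (fun n _ h => h.1.le)).trans
        (div_le_div_of_nonneg_right hcount3b (by positivity))
    have hN : (⌊2 * Real.exp (1 / H) * X⌋₊ : ℝ) ≤ 2 * Real.exp (1 / H) * X :=
      Nat.floor_le (by positivity)
    have hR1 : 5 * T + 18 * (⌊2 * Real.exp (1 / H) * X⌋₊ : ℝ) ≤ 108 * (T + X) := by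
      nlinarith only [hN, he3, hX0, hT0]
    calc _ ≤ (5 * T + 18 * (⌊2 * Real.exp (1 / H) * X⌋₊ : ℝ)) * ((4 * X / H + 1) / (2 * X) ^ 2) :=
          IE3b.trans (mul_le_mul_of_nonneg_left hsum (by positivity))
      _ ≤ (108 * (T + X)) * ((4 * X / H + 1) / (2 * X) ^ 2) :=
          mul_le_mul_of_nonneg_right hR1 (by positivity)
  -- the part with a prime factor in `[P, Q]`, bounded wholesale (used when the main term is degenerate)
  have hdivsub : (Nn[X]).filter (fun n => ¬ ∀ p ∈ Pr[P, Q], ¬ p ∣ n) ⊆ Icc 1 ⌊2 * X⌋₊ :=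
    (filter_subset _ _).trans (Nn_subset hX0)
  have IDiv : ∫ t in 𝒯, ‖∑ n ∈ (Nn[X]).filter (fun n => ¬ ∀ p ∈ Pr[P, Q], ¬ p ∣ n),
      a n * cw[t, n]‖ ^ 2 ≤ (36 * (T + X)) *
        (#((Nn[X]).filter (fun n => ¬ ∀ p ∈ Pr[P, Q], ¬ p ∣ n)) / X ^ 2) := by
    refine (meanvalue_subset _ _ hdivsub a hT0 h𝒯).trans ?_
    have hterm : ∀ n ∈ (Nn[X]).filter (fun n => ¬ ∀ p ∈ Pr[P, Q], ¬ p ∣ n),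
        ‖a n‖ ^ 2 / (n : ℝ) ^ 2 ≤ 1 / X ^ 2 := by
      intro n hn
      have hXn : X ≤ n := hNn1 n (mem_filter.1 hn).1
      have h1 : ‖a n‖ ^ 2 ≤ 1 := by
        have := ha n
        have h0 := norm_nonneg (a n)
        nlinarith only [this, h0]
      calc ‖a n‖ ^ 2 / (n : ℝ) ^ 2 ≤ 1 / (n : ℝ) ^ 2 :=
            div_le_div_of_nonneg_right h1 (by positivity)
        _ ≤ 1 / X ^ 2 := div_le_div_of_nonneg_left zero_le_one (by positivity)
            (pow_le_pow_left₀ hX0.le hXn 2)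
    calc (5 * T + 18 * (⌊2 * X⌋₊ : ℝ)) *
          ∑ n ∈ (Nn[X]).filter (fun n => ¬ ∀ p ∈ Pr[P, Q], ¬ p ∣ n), ‖a n‖ ^ 2 / (n : ℝ) ^ 2
        ≤ (36 * (T + X)) *
          ∑ n ∈ (Nn[X]).filter (fun n => ¬ ∀ p ∈ Pr[P, Q], ¬ p ∣ n), (1 / X ^ 2 : ℝ) :=
          mul_le_mul hR0 (sum_le_sum hterm) (sum_nonneg fun n _ => by positivity) (by positivity)
      _ = _ := by rw [sum_const, nsmul_eq_mul]; ring
  -- Two regimes.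
  by_cases hreg : P ≤ 2 * X ∧ 1 ≤ H * Real.log (Q / P)
  · -- Main regime: use the full decomposition.
    obtain ⟨hP2X, hL1⟩ := hreg
    have hXP : 1 / X ≤ 2 / P := by
      rw [div_le_div_iff₀ hX0 hP0]; linarith only [hP2X]
    have hI3 : (#(Icc ⌊H * Real.log P⌋₊ ⌊H * Real.log Q⌋₊) : ℝ) ≤ 3 * (H * Real.log (Q / P)) := by
      linarith only [hI, hL1]
    have IMain' : ∫ t in 𝒯, ‖∑ j ∈ Icc ⌊H * Real.log P⌋₊ ⌊H * Real.log Q⌋₊,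
        blockPrimePoly c P Q H j t * blockCofactorPoly b X P Q H j t‖ ^ 2 ≤
          3 * (H * Real.log (Q / P)) * ∑ j ∈ Icc ⌊H * Real.log P⌋₊ ⌊H * Real.log Q⌋₊,
            ∫ t in 𝒯, ‖blockPrimePoly c P Q H j t * blockCofactorPoly b X P Q H j t‖ ^ 2 :=
      IMain.trans (mul_le_mul_of_nonneg_right hI3 hSmain0)
    have IE3a'' : (36 * (T + X)) * ((2 * X / H + 1) / X ^ 2) ≤
        72 * ((T + X) / X) * (1 / H + 1 / P) := by
      have : (2 * X / H + 1) / X ^ 2 = (2 / H) * (1 / X) + (1 / X) * (1 / X) := by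
        field_simp
      rw [this]
      have h1 : (2 / H) * (1 / X) + (1 / X) * (1 / X) ≤ (2 / H) * (1 / X) + (2 / P) * (1 / X) := by
        have hX1 : (0 : ℝ) ≤ 1 / X := by positivity
        have h2 : (1 / X) * (1 / X) ≤ (2 / P) * (1 / X) := mul_le_mul_of_nonneg_right hXP hX1
        linarith only [h2]
      calc (36 * (T + X)) * ((2 / H) * (1 / X) + (1 / X) * (1 / X))
          ≤ (36 * (T + X)) * ((2 / H) * (1 / X) + (2 / P) * (1 / X)) :=
            mul_le_mul_of_nonneg_left h1 (by positivity)
        _ = 72 * ((T + X) / X) * (1 / H + 1 / P) := by ring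
    have IE3b'' : (108 * (T + X)) * ((4 * X / H + 1) / (2 * X) ^ 2) ≤
        108 * ((T + X) / X) * (1 / H + 1 / P) := by
      have : (4 * X / H + 1) / (2 * X) ^ 2 = (1 / H) * (1 / X) + (1 / 4) * ((1 / X) * (1 / X)) := by
        field_simp
        ring
      rw [this]
      have h1 : (1 / H) * (1 / X) + (1 / 4) * ((1 / X) * (1 / X)) ≤
          (1 / H) * (1 / X) + (1 / P) * (1 / X) := by
        have hX1 : (0 : ℝ) ≤ 1 / X := by positivity
        have h4 : (2 : ℝ) / P = 2 * (1 / P) := by ring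
        have h2 : (1 / X) * (1 / X) ≤ (2 * (1 / P)) * (1 / X) :=
          mul_le_mul_of_nonneg_right (hXP.trans_eq h4) hX1
        have h3 : (0 : ℝ) ≤ (2 * (1 / P)) * (1 / X) := by positivity
        linarith only [h2, h3]
      calc (108 * (T + X)) * ((1 / H) * (1 / X) + (1 / 4) * ((1 / X) * (1 / X)))
          ≤ (108 * (T + X)) * ((1 / H) * (1 / X) + (1 / P) * (1 / X)) :=
            mul_le_mul_of_nonneg_left h1 (by positivity)
        _ = 108 * ((T + X) / X) * (1 / H + 1 / P) := by ring
    have hRpos : 0 ≤ (T + X) / X := by positivity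
    have hinvH : 0 ≤ 1 / H := by positivity
    have hinvP : 0 ≤ 1 / P := by positivity
    have key : ∀ {F IM I3a I3b I2 I1 ICp L S R iH iP Sc : ℝ},
        F ≤ 6 * (IM + I3a + I3b + I2 + I1 + ICp) → IM ≤ 3 * L * S → I3a ≤ 72 * R * (iH + iP) →
        I3b ≤ 108 * R * (iH + iP) → I2 ≤ 144 * R * iP → I1 ≤ 144 * R * iP → ICp ≤ 36 * R * Sc →
        0 ≤ L * S → 0 ≤ R * Sc → 0 ≤ R * iH → 0 ≤ R * iP →
        F ≤ 20000 * (L * S + R * (iH + iP + Sc)) := by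
      intros
      linarith
    exact key step1 IMain' (IE3a'.trans IE3a'') (IE3b'.trans IE3b'') IE2' IE1' ICop
      (mul_nonneg hL0 hSmain0) (mul_nonneg hRpos hScop0) (mul_nonneg hRpos hinvH)
      (mul_nonneg hRpos hinvP)
  · -- Degenerate regime: `P > 2X` (nothing in `[X,2X]` has a prime factor in `[P,Q]`) or
    -- `H log(Q/P) < 1` (few primes): bound `F = F_cop + F_div` wholesale.
    have hcountD : (#((Nn[X]).filter (fun n => ¬ ∀ p ∈ Pr[P, Q], ¬ p ∣ n)) : ℝ) ≤
        4 * X / H + 2 * X / P := by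
      rcases not_and_or.1 hreg with h1 | h2
      · -- `2X < P`: the set is empty
        have : (Nn[X]).filter (fun n => ¬ ∀ p ∈ Pr[P, Q], ¬ p ∣ n) = ∅ := by
          rw [filter_eq_empty_iff]
          intro n hn hnot
          apply hnot
          intro p hp hpn
          have hn1 : 1 ≤ n := (mem_Icc.1 (Nn_subset hX0 hn)).1
          have hn2 : (n : ℝ) ≤ 2 * X := (Nat.le_floor_iff (by positivity)).1 (mem_Icc.1 hn).2
          have hPp : P ≤ p := ((mem_Pr hQ0).1 hp).2.1
          have hpn' : (p : ℝ) ≤ n := by exact_mod_cast Nat.le_of_dvd hn1 hpn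
          linarith only [hn2, hPp, hpn', h1]
        rw [this, card_empty, Nat.cast_zero]
        positivity
      · -- `H log (Q/P) < 1`: `Q < P e^{1/H}`, so `#Pr ≤ 2P/H + 1`
        push Not at h2
        have hQP : Q < P * Real.exp (1 / H) := by
          have : Real.log (Q / P) < 1 / H := by
            rw [lt_div_iff₀ hH0, mul_comm]; exact h2
          have := (Real.log_lt_iff_lt_exp (div_pos hQpos hP0)).1 this
          rwa [div_lt_iff₀ hP0, mul_comm] at this
        have hPr : (#(Pr[P, Q]) : ℝ) ≤ 2 * P / H + 1 :=
          calc (#(Pr[P, Q]) : ℝ) ≤ Q - P + 1 := card_Pr_le hP0.le hPQ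
            _ ≤ P * (Real.exp (1 / H) - 1) + 1 := by linarith only [hQP]
            _ ≤ P * (2 / H) + 1 := by gcongr
            _ = 2 * P / H + 1 := by ring
        calc (#((Nn[X]).filter (fun n => ¬ ∀ p ∈ Pr[P, Q], ¬ p ∣ n)) : ℝ)
            ≤ #((Icc 1 ⌊2 * X⌋₊).filter (fun n => ∃ p ∈ Pr[P, Q], p ∣ n)) := by
              exact_mod_cast card_le_card (fun n hn => by
                rw [mem_filter] at hn ⊢
                refine ⟨Nn_subset hX0 hn.1, ?_⟩
                have := hn.2
                push Not at this
                exact this)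
          _ ≤ ∑ p ∈ Pr[P, Q], (⌊2 * X⌋₊ : ℝ) / p := card_filter_exists_dvd_le _ _
          _ ≤ ∑ p ∈ Pr[P, Q], 2 * X / P := sum_le_sum fun p hp => by
              have hPp : P ≤ p := ((mem_Pr hQ0).1 hp).2.1
              calc (⌊2 * X⌋₊ : ℝ) / p ≤ (2 * X) / p := div_le_div_of_nonneg_right hM (by positivity)
                _ ≤ 2 * X / P := div_le_div_of_nonneg_left (by positivity) hP0 hPp
          _ = #(Pr[P, Q]) * (2 * X / P) := by rw [sum_const, nsmul_eq_mul]
          _ ≤ (2 * P / H + 1) * (2 * X / P) := mul_le_mul_of_nonneg_right hPr (by positivity)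
          _ = 4 * X / H + 2 * X / P := by field_simp; ring
    -- pointwise `|F|² ≤ 2 |F_cop|² + 2 |F_div|²`
    have hsplit : ∀ t : ℝ, ∑ n ∈ Nn[X], a n * cw[t, n] =
        ∑ n ∈ (Nn[X]).filter (fun n => ∀ p ∈ Pr[P, Q], ¬ p ∣ n), a n * cw[t, n] +
          ∑ n ∈ (Nn[X]).filter (fun n => ¬ ∀ p ∈ Pr[P, Q], ¬ p ∣ n), a n * cw[t, n] :=
      fun t => (sum_filter_add_sum_filter_not _ _ _).symm
    have hpt2 := fun t : ℝ =>
      (congrArg (fun z : ℂ => ‖z‖ ^ 2) (hsplit t)).trans_le (norm_sq_two_le _ _)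
    beta_reduce at hpt2
    have cDiv : Continuous fun t : ℝ =>
        ∑ n ∈ (Nn[X]).filter (fun n => ¬ ∀ p ∈ Pr[P, Q], ¬ p ∣ n), a n * cw[t, n] :=
      continuous_dsum _ _
    have step2 := integral_two_le h𝒯 _ _ _ cCop cDiv hpt2
    beta_reduce at step2
    have IDiv' : (36 * (T + X)) *
        (#((Nn[X]).filter (fun n => ¬ ∀ p ∈ Pr[P, Q], ¬ p ∣ n)) / X ^ 2) ≤
          144 * ((T + X) / X) * (1 / H + 1 / P) := by
      calc (36 * (T + X)) * (#((Nn[X]).filter (fun n => ¬ ∀ p ∈ Pr[P, Q], ¬ p ∣ n)) / X ^ 2)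
          ≤ (36 * (T + X)) * ((4 * X / H + 2 * X / P) / X ^ 2) := by gcongr
        _ = ((T + X) / X) * (144 * (1 / H) + 72 * (1 / P)) := by field_simp; ring
        _ ≤ 144 * ((T + X) / X) * (1 / H + 1 / P) := by
            have hRpos : 0 ≤ (T + X) / X := by positivity
            have h72 : (0 : ℝ) ≤ 72 * ((T + X) / X * (1 / P)) := by positivity
            linarith only [h72]
    have hRpos : 0 ≤ (T + X) / X := by positivity
    have hinvH : 0 ≤ 1 / H := by positivity
    have hinvP : 0 ≤ 1 / P := by positivity
    have key : ∀ {F ICp IDv L S R iH iP Sc : ℝ},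
        F ≤ 2 * (ICp + IDv) → ICp ≤ 36 * R * Sc → IDv ≤ 144 * R * (iH + iP) →
        0 ≤ L * S → 0 ≤ R * Sc → 0 ≤ R * iH → 0 ≤ R * iP →
        F ≤ 20000 * (L * S + R * (iH + iP + Sc)) := by
      intros
      linarith
    exact key step2 ICop (IDiv.trans IDiv') (mul_nonneg hL0 hSmain0) (mul_nonneg hRpos hScop0)
      (mul_nonneg hRpos hinvH) (mul_nonneg hRpos hinvP)

end MatomakiRadziwillLemma12

/-- NAMED FACT — **Matomäki–Radziwiłł 2016, Lemma 12** (the Ramaré–Buchstab-type decomposition), as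
printed and correctly parenthesised: "Let `H ≥ 1` and `Q ≥ P ≥ 1`. Let `a_m`, `b_m` and `c_p` be bounded
sequences such that `a_{mp} = b_m c_p` whenever `p ∤ m` and `P ≤ p ≤ Q`. Let
`Q_{v,H}(s) = ∑_{P ≤ p ≤ Q, e^{v/H} ≤ p ≤ e^{(v+1)/H}} c_p p^{-s}` and
`R_{v,H}(s) = ∑_{Xe^{-v/H} ≤ m ≤ 2Xe^{-v/H}} b_m m^{-s} · 1/(#{P ≤ q ≤ Q : q ∣ m, q ∈ ℙ} + 1)`, and let
`𝒯 ⊆ [-T, T]`. Then `∫_𝒯 |∑_{X ≤ n ≤ 2X} a_n n^{-1-it}|² dt ≪ H log(Q/P) × ∑_{j ∈ ℐ} ∫_𝒯 |Q_{j,H}(1+it)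
R_{j,H}(1+it)|² dt + (T+X)/X · (1/H + 1/P + ∑_{X ≤ n ≤ 2X, (n, ∏_{P ≤ p ≤ Q} p) = 1} |a_n|²/n)`, where `ℐ`
is the interval `⌊H log P⌋ ≤ j ≤ H log Q`."  Renderings exactly as in `MatomakiRadziwill2016_lemma12`
(`MatomakiRadziwillProp1Inputs.lean`: "bounded" = bounded by `1`, absolute `C`, `𝒯` measurable,
`T, X ≥ 1`, natural `j ∈ [⌊H log P⌋, H log Q]`, half-open prime blocks `blockPrimePoly`, cofactor
polynomial `blockCofactorPoly`), the only difference being the parentheses: here the main term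
`H log(Q/P) · (∑_j ∫_𝒯 |Q_j R_j|²)` and the error term `(T+X)/X · (…)` are the two summands inside
`C · (…)`, as in the source, whereas in `MatomakiRadziwill2016_lemma12` the body of `∫ t in 𝒯,` runs on
over `+ (T+X)/X · (…)` (refuted below, `not_MatomakiRadziwill2016_lemma12`).  PROVED:
`MatomakiRadziwill2016_lemma12_decomp_holds`. [cite: MatomakiRadziwillAnnals2016, Lemma 12] -/
def MatomakiRadziwill2016_lemma12_decomp : Prop :=
  ∃ C : ℝ, ∀ (X T P Q H : ℝ) (a b c : ℕ → ℂ) (𝒯 : Set ℝ), 1 ≤ X → 1 ≤ T → 1 ≤ P → P ≤ Q → 1 ≤ H →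
    (∀ n, ‖a n‖ ≤ 1) → (∀ m, ‖b m‖ ≤ 1) → (∀ p, ‖c p‖ ≤ 1) →
    (∀ m p : ℕ, p.Prime → P ≤ p → (p : ℝ) ≤ Q → ¬ p ∣ m → a (m * p) = b m * c p) →
    MeasurableSet 𝒯 → 𝒯 ⊆ Set.Icc (-T) T →
    ∫ t in 𝒯, ‖∑ n ∈ Icc ⌈X⌉₊ ⌊2 * X⌋₊, a n * (n : ℂ) ^ (-(1 + (t : ℂ) * I))‖ ^ 2 ≤
      C * ((H * Real.log (Q / P)) *
              (∑ j ∈ Icc ⌊H * Real.log P⌋₊ ⌊H * Real.log Q⌋₊,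
                ∫ t in 𝒯, ‖blockPrimePoly c P Q H j t * blockCofactorPoly b X P Q H j t‖ ^ 2)
            + (T + X) / X * (1 / H + 1 / P
                + ∑ n ∈ (Icc ⌈X⌉₊ ⌊2 * X⌋₊).filter
                    (fun n : ℕ => ∀ p ∈ (Icc ⌈P⌉₊ ⌊Q⌋₊).filter Nat.Prime, ¬ p ∣ n),
                    ‖a n‖ ^ 2 / n))

/-- **Matomäki–Radziwiłł 2016, Lemma 12** (PROVED), discharging `MatomakiRadziwill2016_lemma12_decomp`
with the absolute constant `C = 20000` (`MatomakiRadziwillLemma12.lemma12_bound`).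
[cite: MatomakiRadziwillAnnals2016, Lemma 12] -/
theorem MatomakiRadziwill2016_lemma12_decomp_holds : MatomakiRadziwill2016_lemma12_decomp :=
  ⟨20000, fun X T P Q H a b c 𝒯 hX hT hP hPQ hH ha hb hc hfac _ h𝒯 =>
    MatomakiRadziwillLemma12.lemma12_bound X T P Q H a b c 𝒯 hX hT hP hPQ hH ha hb hc hfac h𝒯⟩

/-- The rendering `MatomakiRadziwill2016_lemma12` of `MatomakiRadziwillProp1Inputs.lean` is
mis-parenthesised (the body of its `∫ t in 𝒯,` swallows the error term, so its right-hand side is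
`C · H log(Q/P) · ∑_j ∫_𝒯 (|Q_j R_j|² + (T+X)/X · (…)) dt`) and is FALSE: with `X = T = H = 1`,
`P = Q = 2`, `a = b = c = 1`, `𝒯 = [-1, 1]` its right-hand side is `0` (`log(Q/P) = 0`) while the
left-hand side `∫_{-1}^{1} |1 + 2^{-1-it}|² dt ≥ 2 · (1/2)² = 1/2`.  Use
`MatomakiRadziwill2016_lemma12_decomp` instead. [folklore] -/
theorem not_MatomakiRadziwill2016_lemma12 : ¬ MatomakiRadziwill2016_lemma12 := by
  rintro ⟨C, hC⟩
  have h := hC 1 1 2 2 1 (fun _ => 1) (fun _ => 1) (fun _ => 1) (Set.Icc (-1) 1) le_rfl le_rfl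
    (by norm_num) le_rfl le_rfl (fun _ => by simp) (fun _ => by simp) (fun _ => by simp)
    (fun _ _ _ _ _ _ => by simp) measurableSet_Icc (by simp)
  -- the right-hand side vanishes
  have hR : Real.log ((2 : ℝ) / 2) = 0 := by norm_num
  rw [hR] at h
  simp only [mul_zero, zero_mul] at h
  -- the left-hand side is at least `1/2`
  have hIcc : Icc ⌈(1 : ℝ)⌉₊ ⌊2 * (1 : ℝ)⌋₊ = {1, 2} := by
    rw [Nat.ceil_one, mul_one, Nat.floor_ofNat]
    decide
  have hpt : ∀ t : ℝ, (1 / 4 : ℝ) ≤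
      ‖∑ n ∈ Icc ⌈(1 : ℝ)⌉₊ ⌊2 * (1 : ℝ)⌋₊, (1 : ℂ) * (n : ℂ) ^ (-(1 + (t : ℂ) * I))‖ ^ 2 := by
    intro t
    rw [hIcc, sum_pair (by norm_num), one_mul, one_mul, Nat.cast_one, Complex.one_cpow]
    have h2 : ‖((2 : ℕ) : ℂ) ^ (-(1 + (t : ℂ) * I))‖ = 1 / 2 := by
      rw [MatomakiRadziwillLemma12.norm_cpw (by norm_num : 0 < 2) t]
      norm_num
    have hlow : (1 / 2 : ℝ) ≤ ‖(1 : ℂ) + ((2 : ℕ) : ℂ) ^ (-(1 + (t : ℂ) * I))‖ := by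
      have htri := norm_add_le ((1 : ℂ) + ((2 : ℕ) : ℂ) ^ (-(1 + (t : ℂ) * I)))
        (-(((2 : ℕ) : ℂ) ^ (-(1 + (t : ℂ) * I))))
      rw [add_neg_cancel_right, norm_one, norm_neg, h2] at htri
      linarith
    calc (1 / 4 : ℝ) = (1 / 2) ^ 2 := by norm_num
      _ ≤ _ := pow_le_pow_left₀ (by norm_num) hlow 2
  have hcont : Continuous fun t : ℝ =>
      ‖∑ n ∈ Icc ⌈(1 : ℝ)⌉₊ ⌊2 * (1 : ℝ)⌋₊, (1 : ℂ) * (n : ℂ) ^ (-(1 + (t : ℂ) * I))‖ ^ 2 :=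
    ((MatomakiRadziwillLemma12.continuous_dsum _ _).norm).pow 2
  have hlow : (1 / 2 : ℝ) ≤ ∫ t in Set.Icc (-1 : ℝ) 1,
      ‖∑ n ∈ Icc ⌈(1 : ℝ)⌉₊ ⌊2 * (1 : ℝ)⌋₊, (1 : ℂ) * (n : ℂ) ^ (-(1 + (t : ℂ) * I))‖ ^ 2 := by
    have hconst : ∫ _ in Set.Icc (-1 : ℝ) 1, (1 / 4 : ℝ) = 1 / 2 := by
      rw [setIntegral_const]
      simp [Measure.real, Real.volume_Icc]
      norm_num
    rw [← hconst]
    exact setIntegral_mono_on (integrableOn_const (by simp [Real.volume_Icc]))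
      hcont.integrableOn_Icc measurableSet_Icc (fun t _ => hpt t)
  have : (1 / 2 : ℝ) ≤ 0 := hlow.trans h
  norm_num at this

end Literature.NumberTheory.Sieve
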